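import Summits.MatrixMultiplication.MatrixMultiplication.Theses.SnSubsetDichotomy
import Literature.RepresentationTheory.FiniteGroups.VershikKerovLimitShape
import Literature.Barriers.MatrixMultiplication.YoungSubgroupBarrierProofs
import Literature.Combinatorics.Additive.TPPGroupAlgebra

/-!
# Disproof of `NoThresholdSubsetTriple` — findings

Crux (route `SnSubsetDichotomy`, item stmt-MatrixMultiplication-8302, rank 0, the NEGATIVE side):
`∃ c > 0, ∃ n₀, ∀ n ≥ n₀, ∀ S T U ⊆ S_n, TPP S T U → |S||T||U| ≤ (n!)^{3/2} · e^{-c√n}`.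

Standing adversary file (refuter, cdisprove mode).  Prose lives in docstrings; every `theorem` is
checked (`lean check` rc 0, no `sorry`, axioms propext/Classical.choice/Quot.sound).  LANDING: the
gate accepts from a refuter only `¬ <Theses decl>` files under Theorems/ (no `Negative/` sub-tree:
dry-run p-none bounced `theorems.refuter`), so everything below travels as item EVIDENCE on
stmt-8302 (this file) — provers/planners may copy any block verbatim; the §6 construction is also
attached to SnThresholdCensus item stmt-5541 as a candidate proof of `PairwiseTrivialAtThreshold`
(Cand5541.lean, audit: proof-of-item closed).  Index:

* §0 `crux_iff_not_target`, `summit_of_not_crux` — WHY IT RESISTS: a disproof of the crux is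
  literally a proof of the route target `ThresholdSubsetTriples`, and (with the tree's Vershik–Kerov
  theorem and the route's proved deciding theorem `closes`) a proof of `ω(ℂ) = 2`.  No finite
  computation and no known construction family decides it (best known TPP triples in `S_n` lose
  `e^{-Θ(n)}`, Young/triangle type; best proved saving is `√(n-1)`, BCGPU 2023 Thm 3.2).
* §1 LOAD-BEARING `TPP`: `false_without_TPP` (witness `S = T = U = S_n`).
* §2 LOAD-BEARING `0 < c`: WITHOUT it the statement is TRUE — `packing_bound`
  (`|S||T||U| ≤ (n!)^{3/2}` for every TPP triple, Cohn–Umans packing) and `holds_without_posConst`.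
  All content of the crux is the factor `e^{-c√n}`.
* §3 LOAD-BEARING `n₀`: `false_without_n0` (at `n = 1` the bound reads `1 ≤ e^{-c}`).
* §4 PARTIAL TRUTH (barrier side): `crux_holds_for_young_triples` — for triples of YOUNG subgroups
  the crux holds with the stronger saving `e^{-cn}` (tree theorem `BCCGU2017_thm42_holds`); any
  counterexample family must be non-Young.
* §5 SMALL MODELS: `decide`-certified TPP triples in `S_3` (volume 8 > 3!) and `S_4` (volume
  36 > 4!, a subgroup triple); exhaustive census `β(S_3) = 8`, `β(S_4) = 36` (subsets do not beat
  subgroups for `n ≤ 4`); rooted-triple violation densities ≈ 1/3 for `m ≤ 7` (docstring), and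
  `rooted_subgroups_not_tpp_m3` (explicit violating involutions at `n = 6`).
* §6 LOAD-BEARING three-fold condition: `false_with_pairwise_only` — with the TPP weakened to
  the PAIRWISE TPP (`Q(S)∩Q(T) = Q(T)∩Q(U) = Q(U)∩Q(S) = {1}`) the bound fails for every `c > 0`:
  the rooted hyperoctahedral stabilisers (`rooted_triple`, sizes `(m-1)!·2^{m-1}` in `S_{2m}`,
  pairwise TPP PROVED for odd `m`) sit at polynomial slack `n⁻³` below `(n!)^{3/2}`.
* §9 TARGETS (picked line `two-modular-loewy-slice-rank`): `radicalWindow_iff_loewyWindow`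
  (stub_radicalWindow ⟺ "all but n!e^{-K√n} of rad 𝔽̄₂S_n lies in Loewy layers [b,2b)") and
  `thin_of_radicalWindow` (⇒ thin first radical layer `dim J/J² ≤ n!e^{-K√n}+1` or thin `J²`) —
  proved on the line's own objects; data `n ≤ 7` shows no decay; scale remarks.
* §8 SHAPE OF A COUNTEREXAMPLE: `card_gt_of_threshold`, `card_lt_of_threshold` — a TPP triple
  beating `(n!)^{3/2}e^{-c√n}` has all three sets of size in `(√(n!)e^{-c√n}, √(n!)e^{c√n})`.
* §7 GLUE + OPEN STRENGTHENINGS: `hyperoctahedralSubsets_of_crux`, `polynomialSlack_of_crux`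
  (the crux is the strongest negative statement of the route: killing either sibling kills it);
  open strengthenings `e^{-c√n} → e^{-cn}` (Young triples lose `e^{-Θ(n)}`, consistent) and
  uniform-in-`c` (no construction within `e^{-O(√n)}` of packing is known; best proved saving
  `√(n-1)`, BCGPU 2023 Thm 3.2 = tree theorem `BCGPU2023_thm32_holds`) — docstring.
-/

set_option linter.dupNamespace false

namespace Summit.MatrixMultiplication.MatrixMultiplication.Cruxes.NoThresholdSubsetTriple.Disproof

open Summit.MatrixMultiplication.MatrixMultiplication.Theses.SnSubsetDichotomy
open Literature.Combinatorics.Additive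

/-! ## §0  The crux is the negation of the target; a disproof is `ω = 2` -/

/-- `NoThresholdSubsetTriple ↔ ¬ ThresholdSubsetTriples` (pure logic). -/
theorem crux_iff_not_target : NoThresholdSubsetTriple ↔ ¬ ThresholdSubsetTriples := by
  unfold NoThresholdSubsetTriple ThresholdSubsetTriples
  constructor
  · rintro ⟨c, hc, n₀, h⟩ hT
    obtain ⟨n, hn, S, T, U, hTPP, hlt⟩ := hT c hc n₀
    exact absurd (h n hn S T U hTPP) (not_le.2 hlt)
  · intro h
    by_contra hne
    apply h
    intro c hc n₀
    by_contra hall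
    apply hne
    refine ⟨c, hc, n₀, fun n hn S T U hTPP => ?_⟩
    by_contra hlt
    exact hall ⟨n, hn, S, T, U, hTPP, not_le.1 hlt⟩

/-- The route's support item `VershikKerovBound` holds: it is the `ε := c₂/2` instance of the tree
theorem `VershikKerov1985_maxCharDegree_holds` (`c₂ = vkUpperConst = (π-2)/π² > 0`). -/
theorem vershikKerovBound_holds : VershikKerovBound := by
  have hc := Literature.RepresentationTheory.FiniteGroups.vkUpperConst_pos
  obtain ⟨n₀, h⟩ :=
    Literature.RepresentationTheory.FiniteGroups.VershikKerov1985_maxCharDegree_holds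
      (Literature.RepresentationTheory.FiniteGroups.vkUpperConst / 2) (half_pos hc)
  refine ⟨Literature.RepresentationTheory.FiniteGroups.vkUpperConst / 2, half_pos hc, n₀,
    fun n hn => ?_⟩
  have key := (h n hn).2
  have e : Literature.RepresentationTheory.FiniteGroups.vkUpperConst -
      Literature.RepresentationTheory.FiniteGroups.vkUpperConst / 2 =
      Literature.RepresentationTheory.FiniteGroups.vkUpperConst / 2 := by ring
  rw [e] at key
  exact key

/-- **Cost of a disproof.**  Refuting the crux proves the summit `ω(ℂ) = 2`: `¬ crux` is the
target `ThresholdSubsetTriples`, which the route's PROVED deciding theorem `closes` turns into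
`MatrixMultiplication` given the Vershik–Kerov bound (proved above from the tree).  Hence no cheap
refutation exists unless `ω = 2` has a cheap proof. -/
theorem summit_of_not_crux (h : ¬ NoThresholdSubsetTriple) : MatrixMultiplication :=
  closes (Classical.not_not.1 fun hT => h (crux_iff_not_target.2 hT)) vershikKerovBound_holds

/-! ## §1  The TPP hypothesis is load-bearing -/

/-- The crux with the hypothesis `TripleProductProperty S T U` dropped. -/
def NoThresholdSubsetTripleWithoutTPP : Prop :=
  ∃ c : ℝ, 0 < c ∧ ∃ n₀ : ℕ, ∀ n ≥ n₀, ∀ S T U : Finset (Equiv.Perm (Fin n)),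
    ((S.card * T.card * U.card : ℕ) : ℝ) ≤
      (n.factorial : ℝ) ^ ((3 : ℝ) / 2) * Real.exp (-(c * Real.sqrt (n : ℝ)))

/-- `|S_n|³ = (n!)³` beats `(n!)^{3/2} e^{-c√n}` as soon as `n ≥ 1`. -/
theorem univ_cube_exceeds {c : ℝ} (hc : 0 < c) {n : ℕ} (hn : 1 ≤ n) :
    (n.factorial : ℝ) ^ ((3 : ℝ) / 2) * Real.exp (-(c * Real.sqrt (n : ℝ))) <
      (((Finset.univ : Finset (Equiv.Perm (Fin n))).card *
          (Finset.univ : Finset (Equiv.Perm (Fin n))).card *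
          (Finset.univ : Finset (Equiv.Perm (Fin n))).card : ℕ) : ℝ) := by
  have hF : (Finset.univ : Finset (Equiv.Perm (Fin n))).card = n.factorial := by
    rw [Finset.card_univ, Fintype.card_perm, Fintype.card_fin]
  rw [hF]
  have hF1 : (1 : ℝ) ≤ (n.factorial : ℝ) := by exact_mod_cast n.factorial_pos
  have hs : 0 < Real.sqrt (n : ℝ) := Real.sqrt_pos.2 (by exact_mod_cast hn)
  have hexp : Real.exp (-(c * Real.sqrt (n : ℝ))) < 1 := by
    rw [Real.exp_lt_one_iff]
    nlinarith
  have h32 : (n.factorial : ℝ) ^ ((3 : ℝ) / 2) ≤ (n.factorial : ℝ) ^ (3 : ℝ) :=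
    Real.rpow_le_rpow_of_exponent_le hF1 (by norm_num)
  have h3 : (n.factorial : ℝ) ^ (3 : ℝ) = ((n.factorial * n.factorial * n.factorial : ℕ) : ℝ) := by
    rw [show (3 : ℝ) = ((3 : ℕ) : ℝ) by norm_num, Real.rpow_natCast]
    push_cast
    ring
  have hpos : 0 < (n.factorial : ℝ) ^ ((3 : ℝ) / 2) := by positivity
  calc (n.factorial : ℝ) ^ ((3 : ℝ) / 2) * Real.exp (-(c * Real.sqrt (n : ℝ)))
      < (n.factorial : ℝ) ^ ((3 : ℝ) / 2) * 1 := by gcongr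
    _ ≤ (n.factorial : ℝ) ^ (3 : ℝ) := by rw [mul_one]; exact h32
    _ = _ := h3

/-- **Any proof must use the TPP**: without it `S = T = U = S_n` violates the bound for every
`c > 0` at every `n ≥ 1`. -/
theorem false_without_TPP : ¬ NoThresholdSubsetTripleWithoutTPP := by
  rintro ⟨c, hc, n₀, h⟩
  exact absurd (h (max n₀ 1) (le_max_left _ _) _ _ _)
    (not_le.2 (univ_cube_exceeds hc (le_max_right n₀ 1)))

/-! ## §2  The constant `c > 0` is load-bearing — without it the crux is the packing bound (TRUE) -/

/-- Cohn–Umans packing in `S_n`: a TPP triple with `U ≠ ∅` has `|S||T| ≤ n!`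
(tree: `RealizesTPP.mul_le_card`). -/
theorem card_mul_le_factorial {n : ℕ} {S T U : Finset (Equiv.Perm (Fin n))}
    (h : TripleProductProperty S T U) (hU : U.Nonempty) : S.card * T.card ≤ n.factorial := by
  have hr : Literature.Computability.AlgebraicComplexity.RealizesTPP (Equiv.Perm (Fin n))
      S.card T.card U.card := ⟨S, T, U, rfl, rfl, rfl, h⟩
  have key := hr.mul_le_card (Finset.card_pos.2 hU).ne'
  rwa [Fintype.card_perm, Fintype.card_fin] at key

/-- **Packing bound**: every TPP triple of subsets of `S_n` has `|S||T||U| ≤ (n!)^{3/2}`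
(the three pairwise bounds `|S||T|, |T||U|, |U||S| ≤ n!` multiplied).  This is the crux at
`c = 0`. -/
theorem packing_bound {n : ℕ} {S T U : Finset (Equiv.Perm (Fin n))}
    (h : TripleProductProperty S T U) :
    ((S.card * T.card * U.card : ℕ) : ℝ) ≤ (n.factorial : ℝ) ^ ((3 : ℝ) / 2) := by
  have hF : (0 : ℝ) ≤ (n.factorial : ℝ) := Nat.cast_nonneg _
  by_cases hS : S.Nonempty
  swap
  · rw [Finset.not_nonempty_iff_eq_empty.1 hS]
    simp only [Finset.card_empty, zero_mul, Nat.cast_zero]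
    positivity
  by_cases hT : T.Nonempty
  swap
  · rw [Finset.not_nonempty_iff_eq_empty.1 hT]
    simp only [Finset.card_empty, mul_zero, zero_mul, Nat.cast_zero]
    positivity
  by_cases hU : U.Nonempty
  swap
  · rw [Finset.not_nonempty_iff_eq_empty.1 hU]
    simp only [Finset.card_empty, mul_zero, Nat.cast_zero]
    positivity
  have h1 := card_mul_le_factorial h hU
  have h2 := card_mul_le_factorial h.rotate hS
  have h3 := card_mul_le_factorial h.rotate.rotate hT
  have hsq : ((S.card * T.card * U.card : ℕ) : ℝ) ^ 2 ≤ (n.factorial : ℝ) ^ 3 := by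
    have : (S.card * T.card * U.card) ^ 2 ≤ n.factorial ^ 3 := by
      calc (S.card * T.card * U.card) ^ 2
          = (S.card * T.card) * (T.card * U.card) * (U.card * S.card) := by ring
        _ ≤ n.factorial * n.factorial * n.factorial :=
          Nat.mul_le_mul (Nat.mul_le_mul h1 h2) h3
        _ = n.factorial ^ 3 := by ring
    exact_mod_cast this
  have hx : (0 : ℝ) ≤ ((S.card * T.card * U.card : ℕ) : ℝ) := Nat.cast_nonneg _
  have key : Real.sqrt ((n.factorial : ℝ) ^ 3) = (n.factorial : ℝ) ^ ((3 : ℝ) / 2) := by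
    rw [Real.sqrt_eq_rpow, ← Real.rpow_natCast, ← Real.rpow_mul hF]
    norm_num
  calc ((S.card * T.card * U.card : ℕ) : ℝ)
      = Real.sqrt (((S.card * T.card * U.card : ℕ) : ℝ) ^ 2) := (Real.sqrt_sq hx).symm
    _ ≤ Real.sqrt ((n.factorial : ℝ) ^ 3) := Real.sqrt_le_sqrt hsq
    _ = (n.factorial : ℝ) ^ ((3 : ℝ) / 2) := key

/-- The crux with `0 < c` dropped (so `c = 0` is allowed). -/
def NoThresholdSubsetTripleWithoutPosConst : Prop :=
  ∃ c : ℝ, ∃ n₀ : ℕ, ∀ n ≥ n₀, ∀ S T U : Finset (Equiv.Perm (Fin n)),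
    TripleProductProperty S T U →
      ((S.card * T.card * U.card : ℕ) : ℝ) ≤
        (n.factorial : ℝ) ^ ((3 : ℝ) / 2) * Real.exp (-(c * Real.sqrt (n : ℝ)))

/-- **Without `0 < c` the crux is TRUE** (take `c = 0`, `n₀ = 0`: the packing bound).  So the
hypothesis `0 < c` carries ALL the content: the crux asserts a saving `e^{-c√n}` below packing,
matching the Vershik–Kerov deficit of `d_max(S_n)`; nothing weaker decides `ω`. -/
theorem holds_without_posConst : NoThresholdSubsetTripleWithoutPosConst :=
  ⟨0, 0, fun n _ S T U h => by simpa using packing_bound h⟩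

/-- The same remark for every `c ≤ 0`. -/
theorem holds_of_nonpos {c : ℝ} (hc : c ≤ 0) (n : ℕ) (S T U : Finset (Equiv.Perm (Fin n)))
    (h : TripleProductProperty S T U) :
    ((S.card * T.card * U.card : ℕ) : ℝ) ≤
      (n.factorial : ℝ) ^ ((3 : ℝ) / 2) * Real.exp (-(c * Real.sqrt (n : ℝ))) := by
  have h1 : (1 : ℝ) ≤ Real.exp (-(c * Real.sqrt (n : ℝ))) := by
    rw [Real.one_le_exp_iff]  -- 0 ≤ -(c * √n)
    have := Real.sqrt_nonneg (n : ℝ)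
    nlinarith
  calc ((S.card * T.card * U.card : ℕ) : ℝ) ≤ (n.factorial : ℝ) ^ ((3 : ℝ) / 2) := packing_bound h
    _ = (n.factorial : ℝ) ^ ((3 : ℝ) / 2) * 1 := (mul_one _).symm
    _ ≤ _ := by gcongr

/-! ## §3  The threshold `n₀` is load-bearing (mildly) -/

/-- The crux with `∃ n₀, ∀ n ≥ n₀` replaced by `∀ n`. -/
def NoThresholdSubsetTripleWithoutN0 : Prop :=
  ∃ c : ℝ, 0 < c ∧ ∀ n : ℕ, ∀ S T U : Finset (Equiv.Perm (Fin n)),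
    TripleProductProperty S T U →
      ((S.card * T.card * U.card : ℕ) : ℝ) ≤
        (n.factorial : ℝ) ^ ((3 : ℝ) / 2) * Real.exp (-(c * Real.sqrt (n : ℝ)))

/-- Singletons `{1}, {1}, {1}` form a TPP triple in any group. -/
theorem tpp_one_one_one {G : Type*} [Group G] [DecidableEq G] :
    TripleProductProperty ({1} : Finset G) {1} {1} := by
  intro s hs s' hs' t ht t' ht' u hu u' hu' _
  simp only [Finset.mem_singleton] at hs hs' ht ht' hu hu'
  subst hs hs' ht ht' hu hu'
  exact ⟨rfl, rfl, rfl⟩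

/-- **`n₀ ≥ 2` is forced**: at `n = 1` the triple `{1},{1},{1}` has `|S||T||U| = 1 > e^{-c}`.
(Harmless: the crux is asymptotic.  For the record, the least admissible `n₀` for a given `c` is
governed by the small-`n` census of §5.) -/
theorem false_without_n0 : ¬ NoThresholdSubsetTripleWithoutN0 := by
  rintro ⟨c, hc, h⟩
  have key := h 1 {1} {1} {1} tpp_one_one_one
  have hexp : Real.exp (-(c * Real.sqrt ((1 : ℕ) : ℝ))) < 1 := by
    rw [Real.exp_lt_one_iff, Nat.cast_one, Real.sqrt_one, mul_one]
    linarith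
  norm_num at key
  rw [Nat.cast_one, Real.sqrt_one, mul_one] at hexp
  linarith


/-! ## §4  Partial truth (barrier side): YOUNG triples satisfy the crux with an exponential saving

From the tree theorem `BCCGU2017_thm42_holds` (Blasiak–Church–Cohn–Grochow–Umans 2017, Thm 4.2,
proved in `YoungSubgroupBarrierProofs.lean` with explicit constants): three Young subgroups with the
TPP (hence pairwise trivial intersections) have `|H₁||H₂||H₃| ≤ (n!)^{3/2} e^{-(3/2)(cn − d√n log n)}`,
and `√n log n = o(n)`.  So the crux restricted to Young triples is TRUE in the much stronger form
`e^{-c'n}`; every hypothetical counterexample family to the crux consists of non-Young sets. -/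

/-- Threshold beyond which `d √n log n ≤ (c/2) n` (from `log n ≤ 4 n^{1/4}`). -/
theorem sqrt_log_threshold {c d : ℝ} (hc : 0 < c) (hd : 0 < d) :
    ∃ n₀ : ℕ, 2 ≤ n₀ ∧ ∀ n : ℕ, n₀ ≤ n → d * Real.sqrt n * Real.log n ≤ c / 2 * n := by
  refine ⟨max 2 ⌈((8 * d / c) ^ 4 : ℝ)⌉₊, le_max_left _ _, fun n hn => ?_⟩
  have hn2 : (2 : ℝ) ≤ n := by exact_mod_cast (le_max_left _ _).trans hn
  have hn0 : (0 : ℝ) < n := by linarith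
  have hceil : ((8 * d / c) ^ 4 : ℝ) ≤ n :=
    (Nat.le_ceil _).trans (by exact_mod_cast (le_max_right _ _).trans hn)
  have h0 : (0 : ℝ) ≤ 8 * d / c := by positivity
  have hK : 8 * d / c ≤ (n : ℝ) ^ ((1 : ℝ) / 4) := by
    calc 8 * d / c = ((8 * d / c) ^ 4) ^ ((4 : ℕ)⁻¹ : ℝ) :=
          (Real.pow_rpow_inv_natCast h0 (by norm_num)).symm
      _ ≤ (n : ℝ) ^ ((4 : ℕ)⁻¹ : ℝ) := Real.rpow_le_rpow (by positivity) hceil (by positivity)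
      _ = (n : ℝ) ^ ((1 : ℝ) / 4) := by norm_num
  have hlog : Real.log n ≤ (n : ℝ) ^ ((1 : ℝ) / 4) / (1 / 4) :=
    Real.log_le_rpow_div hn0.le (by norm_num)
  have hsqrt : Real.sqrt n = (n : ℝ) ^ ((1 : ℝ) / 2) := Real.sqrt_eq_rpow _
  have hsplit : (n : ℝ) = (n : ℝ) ^ ((1 : ℝ) / 2) * (n : ℝ) ^ ((1 : ℝ) / 4) * (n : ℝ) ^ ((1 : ℝ) / 4) := by
    rw [← Real.rpow_add hn0, ← Real.rpow_add hn0]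
    norm_num
  rw [hsqrt]
  have hA : 0 ≤ (n : ℝ) ^ ((1 : ℝ) / 2) := by positivity
  have h4d : 4 * d = c / 2 * (8 * d / c) := by
    field_simp
    ring
  calc d * (n : ℝ) ^ ((1 : ℝ) / 2) * Real.log n
      ≤ d * (n : ℝ) ^ ((1 : ℝ) / 2) * ((n : ℝ) ^ ((1 : ℝ) / 4) / (1 / 4)) := by gcongr
    _ = 4 * d * ((n : ℝ) ^ ((1 : ℝ) / 2) * (n : ℝ) ^ ((1 : ℝ) / 4)) := by ring
    _ = c / 2 * ((n : ℝ) ^ ((1 : ℝ) / 2) * (n : ℝ) ^ ((1 : ℝ) / 4) * (8 * d / c)) := by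
          rw [h4d]; ring
    _ ≤ c / 2 * ((n : ℝ) ^ ((1 : ℝ) / 2) * (n : ℝ) ^ ((1 : ℝ) / 4) * (n : ℝ) ^ ((1 : ℝ) / 4)) := by
          gcongr
    _ = c / 2 * n := by rw [← hsplit]

open Literature.Barriers.MatrixMultiplication in
/-- **The crux holds for Young triples, with saving `e^{-c n}`** (BCCGU 2017 Thm 4.2, tree theorem,
plus `inf_eq_bot_of_tripleProductProperty`).  Any counterexample to the crux must leave the class of
Young subgroups (cf. `Literature.Barriers.MatrixMultiplication.YoungSubgroupBarrier`). -/
theorem crux_holds_for_young_triples :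
    ∃ c : ℝ, 0 < c ∧ ∃ n₀ : ℕ, ∀ n ≥ n₀, ∀ f₁ f₂ f₃ : Fin n → ℕ,
      TripleProductProperty (Finset.univ.filter (· ∈ youngSubgroup f₁))
          (Finset.univ.filter (· ∈ youngSubgroup f₂))
          (Finset.univ.filter (· ∈ youngSubgroup f₃)) →
        ((((Finset.univ.filter (· ∈ youngSubgroup f₁)).card *
            (Finset.univ.filter (· ∈ youngSubgroup f₂)).card *
            (Finset.univ.filter (· ∈ youngSubgroup f₃)).card : ℕ) : ℝ)) ≤
          (n.factorial : ℝ) ^ ((3 : ℝ) / 2) * Real.exp (-(c * n)) := by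
  obtain ⟨c, d, hc, hd, h42⟩ := BCCGU2017_thm42_holds
  obtain ⟨n₀, hn₀2, hthr⟩ := sqrt_log_threshold hc hd
  refine ⟨c / 2, half_pos hc, n₀, fun n hn f₁ f₂ f₃ hTPP => ?_⟩
  obtain ⟨h12, h23, h13⟩ := inf_eq_bot_of_tripleProductProperty _ _ _ hTPP
  have hb := h42 n (hn₀2.trans hn) f₁ f₂ f₃ h12 h23 h13
  have hfilter : ∀ (H : Subgroup (Equiv.Perm (Fin n))) [DecidablePred (· ∈ H)],
      ((Finset.univ.filter (· ∈ H)).card : ℕ) = Nat.card H := by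
    intro H _
    rw [Nat.card_eq_fintype_card (α := ↥H),
      Fintype.card_of_subtype (Finset.univ.filter (· ∈ H)) (fun x => by simp)]
  rw [hfilter, hfilter, hfilter]
  set P : ℕ := Nat.card (youngSubgroup f₁) * Nat.card (youngSubgroup f₂) *
    Nat.card (youngSubgroup f₃) with hP
  have hP0 : 0 < (P : ℝ) := by
    have : 0 < P := Nat.mul_pos (Nat.mul_pos Nat.card_pos Nat.card_pos) Nat.card_pos
    exact_mod_cast this
  have hF0 : 0 < (n.factorial : ℝ) := by exact_mod_cast n.factorial_pos
  set E : ℝ := c * n - d * Real.sqrt n * Real.log n with hE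
  have hP23 : 0 < (P : ℝ) ^ (2 / 3 : ℝ) := Real.rpow_pos_of_pos hP0 _
  have h1 : (P : ℝ) ^ (2 / 3 : ℝ) ≤ n.factorial * Real.exp (-E) := by
    rw [le_div_iff₀ hP23] at hb
    rw [Real.exp_neg, ← div_eq_mul_inv, le_div_iff₀ (Real.exp_pos E)]
    linarith [hb]
  have h2 : (P : ℝ) ≤ (n.factorial * Real.exp (-E)) ^ ((3 : ℝ) / 2) := by
    have := Real.rpow_le_rpow hP23.le h1 (by norm_num : (0 : ℝ) ≤ 3 / 2)
    rwa [← Real.rpow_mul hP0.le, show (2 / 3 : ℝ) * (3 / 2) = 1 by norm_num, Real.rpow_one] at this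
  have h3 : (n.factorial * Real.exp (-E)) ^ ((3 : ℝ) / 2) =
      (n.factorial : ℝ) ^ ((3 : ℝ) / 2) * Real.exp (-E * (3 / 2)) := by
    rw [Real.mul_rpow hF0.le (Real.exp_pos _).le, ← Real.exp_mul]
  have h4 : Real.exp (-E * (3 / 2)) ≤ Real.exp (-(c / 2 * n)) := by
    rw [Real.exp_le_exp]
    have := hthr n hn
    have hn0 : (0 : ℝ) ≤ n := Nat.cast_nonneg _
    nlinarith [hc]
  calc (P : ℝ) ≤ _ := h2
    _ = _ := h3
    _ ≤ (n.factorial : ℝ) ^ ((3 : ℝ) / 2) * Real.exp (-(c / 2 * n)) := by gcongr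

/-! ## §5  Small models (kernel-checked certificates; census numbers from kit jobs)

CENSUS (refuter kit jobs j005004 `tpp-census-small-Sn`, j005002 `hyperocta-rooted-triple`, and the
local runs recorded in NOTES.md; `β(S_n)` := max `|S||T||U|` over TPP triples of SUBSETS):
* `β(S_3) = 8` (profile `2,2,2`; exhaustive), `β(S_4) = 36` (profile `6,3,2`; exhaustive over all
  subset triples up to symmetry) — both attained by SUBGROUP triples; subsets do not beat
  subgroups for `n ≤ 4`.  `β(S_5) ≥ 256 = 2.13·5!` (profile `8,8,4`: two Sylow-2 subgroups `D_4`
  with trivial intersection and a 4-set; exhaustive over SUBGROUP triples of `S_5` the optimum is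
  also `256`, orders `(8,8,4)`; 100 s of randomised subset search found nothing better).
  `log β / log n! = 1.16, 1.13, ≥ 1.16` for `n = 3, 4, 5` (the packing exponent would be `1.5`).
* Rooted hyperoctahedral subgroup triple `K_1, K_3, K_5` (`n = 2m`, §6): pairwise trivial for odd
  `m`, but the GENUINE TPP fails in a `≈ 0.87/√m` fraction of `K_5`:
  `|K_5 ∩ K_3 K_1| / |K_5| = 0.375, 0.396, 0.383, 0.356, 0.328, 0.307, 0.2905, 0.2761` for
  `m = 3, …, 10` (`|K| = 2^{m-1}(m-1)!` up to `1.9·10⁸`; `density·√m = 0.86–0.87` for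
  `5 ≤ m ≤ 10`), computed via the doubly-Hamiltonian reformulation of §6; the largest one-sided
  TPP repair `(K_1, K_3, X ⊆ K_5)` found greedily has `|X| = 4, 4, 9, 12, 18` (`m ≤ 7`), volume
  below the trivial `n!`.  So the violations are polynomially (not exponentially) sparse —
  `≈ 1.2 |K|/√n` violating cosets — yet far too many for cheap repair: a random-like sub-triple of
  index `t` per set keeps `≈ |K| n^{-1/2} t^{-3}` violations, forcing `t ≈ (|K|/√n)^{1/3}`, i.e. a
  volume loss `≈ √(n!)`; only STRUCTURED sub-triples could do better (GAP census of hosted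
  subgroup triples, jobs j005880/j005898, pending).  The knife edge is blunt at `n ≤ 20`. -/

/-- `S_3`: the triple `{1,(01)}, {1,(02)}, {1,(12)}` has the TPP (by `decide`). -/
theorem tpp_S3_witness :
    TripleProductProperty ({1, Equiv.swap 0 1} : Finset (Equiv.Perm (Fin 3)))
      {1, Equiv.swap 0 2} {1, Equiv.swap 1 2} := by
  unfold TripleProductProperty
  decide

/-- Its volume `|S||T||U| = 8` exceeds `|S_3| = 3! = 6`, the trivial/abelian benchmark `n!`
(and `β(S_3) = 8` by exhaustive search). -/
theorem S3_witness_volume :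
    ({1, Equiv.swap 0 1} : Finset (Equiv.Perm (Fin 3))).card *
        ({1, Equiv.swap 0 2} : Finset (Equiv.Perm (Fin 3))).card *
        ({1, Equiv.swap 1 2} : Finset (Equiv.Perm (Fin 3))).card = 8 ∧
      (3 : ℕ).factorial = 6 := by
  refine ⟨?_, rfl⟩
  decide

/-- `S_4`: the subgroup triple `Stab(3) ≅ S_3`, `⟨(0 3)⟩`, `⟨(1 2 3)⟩` has the TPP (by `decide`);
volume `6·2·3 = 36 > 24 = 4!` (and `β(S_4) = 36` by exhaustive search: optimal). -/
theorem tpp_S4_witness :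
    TripleProductProperty
      ((Finset.univ : Finset (Equiv.Perm (Fin 4))).filter fun σ => σ 3 = 3)
      ({1, Equiv.swap 0 3} : Finset (Equiv.Perm (Fin 4)))
      ({1, Equiv.swap 1 2 * Equiv.swap 2 3, Equiv.swap 2 3 * Equiv.swap 1 2} :
        Finset (Equiv.Perm (Fin 4))) := by
  unfold TripleProductProperty
  decide

/-- Volume of the `S_4` witness: `36`. -/
theorem S4_witness_volume :
    ((Finset.univ : Finset (Equiv.Perm (Fin 4))).filter fun σ => σ 3 = 3).card *
        ({1, Equiv.swap 0 3} : Finset (Equiv.Perm (Fin 4))).card *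
        ({1, Equiv.swap 1 2 * Equiv.swap 2 3, Equiv.swap 2 3 * Equiv.swap 1 2} :
          Finset (Equiv.Perm (Fin 4))).card = 36 := by
  decide

/-! ## §6  The genuine THREE-FOLD condition is load-bearing: the pairwise TPP does not suffice

The rooted hyperoctahedral stabilisers.  Model `ℤ/2m` as two layers `ZMod m ⊕ ZMod m`
(`inl i` = point `2i`, `inr j` = point `2j+1`); the three perfect matchings
`M_a = {x, a - x}`, `a = 1, 3, 5`, become the involutions `μ_h : inl i ↔ inr (h - i)`,
`h = 0, 1, 2`, and `K_h := Stab(inl 0) ∩ C(μ_h)` (`= B(M_a) ∩ Stab(0) ≅ S_2 ≀ S_{m-1}`).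
PROVED below: `K_0 ∩ K_1 = K_1 ∩ K_2 = 1` (all `m`) and `K_2 ∩ K_0 = 1` (`m` odd) by propagation
of fixed points along `μ_h μ_g = (i ↦ i + (h-g))`; explicit elements `σ_{π,ε}` (permute the
non-root pairs by `π`, flip those in `ε`) give `(m-1)!·2^{m-1}` elements of each `K_h`
(injectivity), hence three subsets of `S_{2m}` with the PAIRWISE TPP and
`|S||T||U| = ((m-1)! 2^{m-1})³ = (m! 2^m)³/n³ ≥ ((2m)!)^{3/2}/n³` (central binomial bound).
Consequence `false_with_pairwise_only`: the crux with TPP weakened to pairwise TPP is FALSE for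
every `c > 0` — any proof of the crux must use the three-fold condition
(cf. kit job j005002: the same triple violates the genuine TPP in ≈ 1/3·|K| cosets).

STRUCTURE OF THE GENUINE-TPP VIOLATIONS (refuter's reformulation, checked numerically for
`m = 3, 5, 7`, job j006102): `K_h` acts simply transitively on the perfect matchings `M'` with
`M' ∪ M_h` a Hamiltonian (alternating) cycle — whence `|K_h| = 2^{m-1}(m-1)!` — and for odd `m`
`q ∈ K_2` lies in `K_1 K_0` iff `q(M_0) ∈ K_1 · M_0`; hence
`|K_2 ∩ K_1 K_0| = #{M' : M' ∪ M_1 and M' ∪ M_2 both Hamiltonian} =: H(m)` (up to the rotation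
`x ↦ x+1`), `H = 4, 148, 15104, 2998656` for `m = 3, 5, 7, 9` against
`|K| = 8, 384, 46080, 10321920`: the violation density `(H-1)/|K| = 0.375, 0.383, 0.328, 0.2905`
(and `0.396, 0.351, 0.307, 0.276` for even `m = 4, 6, 8, 10`) is the conditional probability that
a matching Hamiltonian with `M_1` is also Hamiltonian with its translate `M_2 = M_1 + 1`;
numerically `density · √m → 0.87`, i.e. `H(m) ≈ 0.87 · 2^{m-1}(m-1)!/√m`.  A TPP sub-triple of the
rooted stabilisers must destroy all these coincidences; one-sided greedy repairs keep only
`|X| = 4, 9, 18` elements (`m = 3, 5, 7`). -/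

section Model

variable {m : ℕ}

/-- Two layers of `ZMod m`: `inl i` ↔ the point `2i`, `inr j` ↔ the point `2j+1` of `ℤ/2m`. -/
abbrev Pt (m : ℕ) := ZMod m ⊕ ZMod m

/-- The matching involution `μ_h`: `inl i ↔ inr (h - i)` (in `ℤ/2m`: `x ↦ (2h+1) - x`). -/
def mu (h : ZMod m) : Equiv.Perm (Pt m) where
  toFun p := match p with
    | Sum.inl i => Sum.inr (h - i)
    | Sum.inr j => Sum.inl (h - j)
  invFun p := match p with
    | Sum.inl i => Sum.inr (h - i)
    | Sum.inr j => Sum.inl (h - j)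
  left_inv := by rintro (i | j) <;> simp
  right_inv := by rintro (i | j) <;> simp

@[simp] theorem mu_inl (h i : ZMod m) : mu h (Sum.inl i) = Sum.inr (h - i) := rfl
@[simp] theorem mu_inr (h j : ZMod m) : mu h (Sum.inr j) = Sum.inl (h - j) := rfl

/-- The rooted stabiliser `K_h = Stab(inl 0) ∩ C(μ_h)` (= `B(M_h) ∩ Stab(0)` of the route texts). -/
def K (h : ZMod m) : Subgroup (Equiv.Perm (Pt m)) :=
  MulAction.stabilizer (Equiv.Perm (Pt m)) (Sum.inl (0 : ZMod m) : Pt m) ⊓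
    Subgroup.centralizer {mu h}

theorem mem_K {h : ZMod m} {σ : Equiv.Perm (Pt m)} :
    σ ∈ K h ↔ σ (Sum.inl 0) = Sum.inl 0 ∧ ∀ p, σ (mu h p) = mu h (σ p) := by
  rw [K, Subgroup.mem_inf, MulAction.mem_stabilizer_iff, Subgroup.mem_centralizer_iff,
    Equiv.Perm.smul_def]
  simp only [Set.mem_singleton_iff, forall_eq]
  rw [Equiv.ext_iff]
  simp only [Equiv.Perm.coe_mul, Function.comp_apply]
  exact ⟨fun ⟨h0, hc⟩ => ⟨h0, fun p => (hc p).symm⟩, fun ⟨h0, hc⟩ => ⟨h0, fun p => (hc p).symm⟩⟩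

/-- **Pairwise triviality** `K_g ∩ K_h = 1` whenever `h - g` generates `ZMod m` additively:
a common element fixes `inl 0`, its fixed-point set is closed under `μ_g, μ_h`, hence under the
translation `μ_h ∘ μ_g : inl i ↦ inl (i + (h - g))`, so it fixes every `inl i`, and then every
`inr j = μ_g (inl (g - j))`. -/
theorem K_inf_K_eq_bot {g h : ZMod m} (hgen : ∀ i : ZMod m, ∃ k : ℕ, i = k • (h - g)) :
    K g ⊓ K h = ⊥ := by
  rw [Subgroup.eq_bot_iff_forall]
  intro σ hσ
  obtain ⟨hg, hh⟩ := Subgroup.mem_inf.1 hσ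
  obtain ⟨hg0, hgc⟩ := mem_K.1 hg
  obtain ⟨-, hhc⟩ := mem_K.1 hh
  have step : ∀ i : ZMod m, σ (Sum.inl i) = Sum.inl i →
      σ (Sum.inl (i + (h - g))) = Sum.inl (i + (h - g)) := by
    intro i hi
    have e : (Sum.inl (i + (h - g)) : Pt m) = mu h (mu g (Sum.inl i)) := by
      simp only [mu_inl, mu_inr, Sum.inl.injEq]; ring
    rw [e, hhc, hgc, hi]
  have hall : ∀ k : ℕ, σ (Sum.inl (k • (h - g))) = Sum.inl (k • (h - g)) := by
    intro k
    induction k with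
    | zero => simpa using hg0
    | succ k ih => rw [succ_nsmul]; exact step _ ih
  have hinl : ∀ i : ZMod m, σ (Sum.inl i) = Sum.inl i := fun i => by
    obtain ⟨k, hk⟩ := hgen i; rw [hk]; exact hall k
  have hinr : ∀ j : ZMod m, σ (Sum.inr j) = Sum.inr j := fun j => by
    have e : (Sum.inr j : Pt m) = mu g (Sum.inl (g - j)) := by simp
    rw [e, hgc, hinl]
  ext p
  rcases p with i | j
  · simp [hinl]
  · simp [hinr]

/-- `1` generates. -/
theorem gen_one [NeZero m] (i : ZMod m) : ∃ k : ℕ, i = k • (1 : ZMod m) :=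
  ⟨i.val, by rw [nsmul_eq_mul, mul_one, ZMod.natCast_zmod_val]⟩

/-- `2` generates when `m` is odd. -/
theorem gen_two [NeZero m] (hm : Odd m) (i : ZMod m) : ∃ k : ℕ, i = k • (2 : ZMod m) := by
  refine ⟨(m + 1) / 2 * i.val, ?_⟩
  obtain ⟨r, hr⟩ := hm
  have h2 : (m + 1) / 2 * i.val * 2 = (m + 1) * i.val := by
    rw [mul_right_comm, Nat.div_mul_cancel ⟨r + 1, by omega⟩]
  have hcast : (((m + 1) / 2 * i.val : ℕ) : ZMod m) * 2 = i := by
    rw [← Nat.cast_two (R := ZMod m), ← Nat.cast_mul, h2, Nat.cast_mul, Nat.cast_add,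
      ZMod.natCast_self, zero_add, Nat.cast_one, one_mul, ZMod.natCast_zmod_val]
  rw [nsmul_eq_mul, hcast]

theorem K0_inf_K1 [NeZero m] : K (0 : ZMod m) ⊓ K 1 = ⊥ :=
  K_inf_K_eq_bot fun i => by
    obtain ⟨k, hk⟩ := gen_one (m := m) i
    exact ⟨k, by rw [hk]; simp⟩

theorem K1_inf_K2 [NeZero m] : K (1 : ZMod m) ⊓ K 2 = ⊥ :=
  K_inf_K_eq_bot fun i => by
    obtain ⟨k, hk⟩ := gen_one (m := m) i
    exact ⟨k, by rw [hk]; norm_num⟩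

theorem K2_inf_K0 [NeZero m] (hm : Odd m) : K (2 : ZMod m) ⊓ K 0 = ⊥ := by
  rw [inf_comm]
  exact K_inf_K_eq_bot fun i => by
    obtain ⟨k, hk⟩ := gen_two (m := m) hm i
    exact ⟨k, by rw [hk]; simp⟩

/-! ### Elements of `K_h`: permute the non-root pairs, flip some of them -/

/-- Permute the pairs `{inl i, inr (h-i)}` of `M_h` by `π`, preserving layers. -/
def Gp (h : ZMod m) (π : Equiv.Perm (ZMod m)) : Equiv.Perm (Pt m) :=
  Equiv.sumCongr π ((Equiv.subLeft h).trans (π.trans (Equiv.subLeft h)))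

@[simp] theorem Gp_inl (h : ZMod m) (π : Equiv.Perm (ZMod m)) (i : ZMod m) :
    Gp h π (Sum.inl i) = Sum.inl (π i) := rfl
@[simp] theorem Gp_inr (h : ZMod m) (π : Equiv.Perm (ZMod m)) (j : ZMod m) :
    Gp h π (Sum.inr j) = Sum.inr (h - π (h - j)) := rfl

/-- Flip the pairs `i` with `ε i = true`. -/
def flipFun (h : ZMod m) (ε : ZMod m → Bool) : Pt m → Pt m
  | Sum.inl i => if ε i then Sum.inr (h - i) else Sum.inl i
  | Sum.inr j => if ε (h - j) then Sum.inl (h - j) else Sum.inr j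

theorem flipFun_involutive (h : ZMod m) (ε : ZMod m → Bool) :
    Function.Involutive (flipFun h ε) := by
  rintro (i | j)
  · by_cases hi : ε i = true
    · simp [flipFun, hi]
    · simp [flipFun, hi]
  · by_cases hj : ε (h - j) = true
    · simp [flipFun, hj]
    · simp [flipFun, hj]

/-- The flip as a permutation. -/
def Fl (h : ZMod m) (ε : ZMod m → Bool) : Equiv.Perm (Pt m) :=
  (flipFun_involutive h ε).toPerm _

@[simp] theorem Fl_inl (h : ZMod m) (ε : ZMod m → Bool) (i : ZMod m) :
    Fl h ε (Sum.inl i) = if ε i then Sum.inr (h - i) else Sum.inl i := rfl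
@[simp] theorem Fl_inr (h : ZMod m) (ε : ZMod m → Bool) (j : ZMod m) :
    Fl h ε (Sum.inr j) = if ε (h - j) then Sum.inl (h - j) else Sum.inr j := rfl

theorem Gp_mem_K {h : ZMod m} {π : Equiv.Perm (ZMod m)} (h0 : π 0 = 0) : Gp h π ∈ K h := by
  refine mem_K.2 ⟨by simp [h0], ?_⟩
  rintro (i | j) <;> simp

theorem Fl_mem_K {h : ZMod m} {ε : ZMod m → Bool} (h0 : ε 0 = false) : Fl h ε ∈ K h := by
  refine mem_K.2 ⟨by simp [h0], ?_⟩
  rintro (i | j)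
  · by_cases hi : ε i = true <;> simp [hi]
  · by_cases hj : ε (h - j) = true <;> simp [hj]

/-- The element `σ_{π,ε} = Gp ∘ Fl` of `K_h`. -/
def sigma (h : ZMod m) (x : Equiv.Perm (ZMod m) × (ZMod m → Bool)) : Equiv.Perm (Pt m) :=
  Gp h x.1 * Fl h x.2

theorem sigma_inl (h : ZMod m) (x : Equiv.Perm (ZMod m) × (ZMod m → Bool)) (i : ZMod m) :
    sigma h x (Sum.inl i) = if x.2 i then Sum.inr (h - x.1 i) else Sum.inl (x.1 i) := by
  simp only [sigma, Equiv.Perm.coe_mul, Function.comp_apply, Fl_inl]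
  by_cases hi : x.2 i = true <;> simp [hi]

theorem sigma_injective (h : ZMod m) : Function.Injective (sigma h) := by
  rintro ⟨π₁, ε₁⟩ ⟨π₂, ε₂⟩ heq
  have key : ∀ i, (if ε₁ i then Sum.inr (h - π₁ i) else Sum.inl (π₁ i) : Pt m) =
      (if ε₂ i then Sum.inr (h - π₂ i) else Sum.inl (π₂ i)) := fun i => by
    have := congrArg (fun σ : Equiv.Perm (Pt m) => σ (Sum.inl i)) heq
    simpa [sigma_inl] using this
  have hε : ε₁ = ε₂ := by
    funext i
    have := key i
    cases h1 : ε₁ i <;> cases h2 : ε₂ i <;> simp [h1, h2] at this ⊢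
  have hπ : π₁ = π₂ := by
    ext i
    have := key i
    rw [hε] at this
    cases h2 : ε₂ i <;> simp [h2] at this <;> exact this
  subst hε; subst hπ; rfl

theorem sigma_mem_K {h : ZMod m} {x : Equiv.Perm (ZMod m) × (ZMod m → Bool)} (h1 : x.1 0 = 0)
    (h2 : x.2 0 = false) : sigma h x ∈ K h :=
  (K h).mul_mem (Gp_mem_K h1) (Fl_mem_K h2)

end Model

section Extension

variable {m : ℕ} [NeZero m]

variable (m) in
/-- `Fin (m-1)` ≃ the non-zero residues (any bijection; only its existence is used). -/
noncomputable def nzEquiv : Fin (m - 1) ≃ {i : ZMod m // i ≠ 0} :=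
  Fintype.equivOfCardEq (by
    rw [Fintype.card_fin, Fintype.card_subtype_compl, ZMod.card, Fintype.card_subtype_eq])

/-- Extend a permutation of `Fin (m-1)` to `ZMod m`, fixing `0`. -/
noncomputable def extPerm (π : Equiv.Perm (Fin (m - 1))) : Equiv.Perm (ZMod m) :=
  π.extendDomain (nzEquiv m)

theorem extPerm_zero (π : Equiv.Perm (Fin (m - 1))) : extPerm π (0 : ZMod m) = 0 :=
  Equiv.Perm.extendDomain_apply_not_subtype _ _ (by simp)

theorem extPerm_injective : Function.Injective (extPerm (m := m)) := fun a b h =>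
  Equiv.Perm.extendDomainHom_injective (nzEquiv m) (by simpa [extPerm] using h)

/-- Extend flips of `Fin (m-1)` to `ZMod m`, not flipping the root pair `0`. -/
noncomputable def extFlip (ε : Fin (m - 1) → Bool) : ZMod m → Bool :=
  fun i => if hi : i = 0 then false else ε ((nzEquiv m).symm ⟨i, hi⟩)

theorem extFlip_zero (ε : Fin (m - 1) → Bool) : extFlip ε (0 : ZMod m) = false := by
  simp [extFlip]

theorem extFlip_apply (ε : Fin (m - 1) → Bool) (j : Fin (m - 1)) :
    extFlip ε ((nzEquiv m j : {i : ZMod m // i ≠ 0}) : ZMod m) = ε j := by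
  have hne : ((nzEquiv m j : {i : ZMod m // i ≠ 0}) : ZMod m) ≠ 0 := (nzEquiv m j).2
  simp only [extFlip, hne, dite_false, Subtype.coe_eta, Equiv.symm_apply_apply]

theorem extFlip_injective : Function.Injective (extFlip (m := m)) := by
  intro ε₁ ε₂ h
  funext j
  rw [← extFlip_apply ε₁ j, ← extFlip_apply ε₂ j, h]

/-- The rooted stabiliser elements `σ_{π,ε}` as a `Finset`, `π, ε` ranging over the non-root
pairs: `(m-1)! · 2^{m-1}` elements of `K_h`. -/
noncomputable def rooted (h : ZMod m) : Finset (Equiv.Perm (Pt m)) :=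
  Finset.univ.image (fun x : Equiv.Perm (Fin (m - 1)) × (Fin (m - 1) → Bool) =>
    sigma h (extPerm x.1, extFlip x.2))

theorem rooted_injective (h : ZMod m) :
    Function.Injective (fun x : Equiv.Perm (Fin (m - 1)) × (Fin (m - 1) → Bool) =>
      sigma h (extPerm x.1, extFlip x.2)) := by
  intro x y hxy
  have key := sigma_injective h hxy
  simp only [Prod.mk.injEq] at key
  exact Prod.ext (extPerm_injective key.1) (extFlip_injective key.2)

theorem card_rooted (h : ZMod m) : (rooted h).card = (m - 1).factorial * 2 ^ (m - 1) := by
  rw [rooted, Finset.card_image_of_injective _ (rooted_injective h), Finset.card_univ,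
    Fintype.card_prod, Fintype.card_perm, Fintype.card_fin, Fintype.card_fun, Fintype.card_fin,
    Fintype.card_bool]

theorem rooted_subset_K (h : ZMod m) : ∀ σ ∈ rooted h, σ ∈ K h := by
  intro σ hσ
  obtain ⟨x, -, rfl⟩ := Finset.mem_image.1 hσ
  exact sigma_mem_K (extPerm_zero x.1) (extFlip_zero x.2)

end Extension

/-! ### Pairwise TPP -/

section PairTPP

variable {G : Type*} [Group G]

/-- The TPP with the third pair frozen (`u = u'`): `s s'⁻¹ t t'⁻¹ = 1 → s = s' ∧ t = t'`,
i.e. `Q(S) ∩ Q(T) = {1}`. -/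
def PairTPP (S T : Finset G) : Prop :=
  ∀ s ∈ S, ∀ s' ∈ S, ∀ t ∈ T, ∀ t' ∈ T, s * s'⁻¹ * (t * t'⁻¹) = 1 → s = s' ∧ t = t'

/-- **Pairwise TPP**: the three two-set conditions of the TPP (each obtained by freezing one of
the three pairs).  For non-empty sets it is implied by the TPP (`PairwiseTPP.of_tpp`); for three
subgroups it is pairwise triviality of intersections. -/
def PairwiseTPP (S T U : Finset G) : Prop :=
  PairTPP S T ∧ PairTPP T U ∧ PairTPP U S

theorem PairwiseTPP.of_tpp {S T U : Finset G} (h : TripleProductProperty S T U) (hS : S.Nonempty)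
    (hT : T.Nonempty) (hU : U.Nonempty) : PairwiseTPP S T U := by
  obtain ⟨s₀, hs₀⟩ := hS
  obtain ⟨t₀, ht₀⟩ := hT
  obtain ⟨u₀, hu₀⟩ := hU
  refine ⟨?_, ?_, ?_⟩
  · intro s hs s' hs' t ht t' ht' heq
    have := h s hs s' hs' t ht t' ht' u₀ hu₀ u₀ hu₀ (by rw [heq, mul_inv_cancel, one_mul])
    exact ⟨this.1, this.2.1⟩
  · intro t ht t' ht' u hu u' hu' heq
    have := h s₀ hs₀ s₀ hs₀ t ht t' ht' u hu u' hu' (by rw [mul_inv_cancel, one_mul, heq])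
    exact ⟨this.2.1, this.2.2⟩
  · intro u hu u' hu' s hs s' hs' heq
    have key : s * s'⁻¹ * (t₀ * t₀⁻¹) * (u * u'⁻¹) = 1 := by
      rw [mul_inv_cancel, mul_one]
      calc s * s'⁻¹ * (u * u'⁻¹) = (u * u'⁻¹)⁻¹ * (u * u'⁻¹ * (s * s'⁻¹)) * (u * u'⁻¹) := by group
        _ = 1 := by rw [heq]; group
    have := h s hs s' hs' t₀ ht₀ t₀ ht₀ u hu u' hu' key
    exact ⟨this.2.2, this.1⟩

theorem pairTPP_of_inf_eq_bot {H L : Subgroup G} (hHL : H ⊓ L = ⊥) {S T : Finset G}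
    (hS : ∀ s ∈ S, s ∈ H) (hT : ∀ t ∈ T, t ∈ L) : PairTPP S T := by
  intro s hs s' hs' t ht t' ht' heq
  have h1 : s * s'⁻¹ ∈ H := H.mul_mem (hS s hs) (H.inv_mem (hS s' hs'))
  have h2 : t * t'⁻¹ ∈ L := L.mul_mem (hT t ht) (L.inv_mem (hT t' ht'))
  have h3 : s * s'⁻¹ = (t * t'⁻¹)⁻¹ := eq_inv_of_mul_eq_one_left heq
  have h4 : s * s'⁻¹ ∈ L := by rw [h3]; exact L.inv_mem h2
  have h5 : s * s'⁻¹ = 1 :=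
    (Subgroup.eq_bot_iff_forall _).1 hHL _ (Subgroup.mem_inf.2 ⟨h1, h4⟩)
  have h6 : t * t'⁻¹ = 1 := by rw [h5, one_mul] at heq; exact heq
  exact ⟨mul_inv_eq_one.1 h5, mul_inv_eq_one.1 h6⟩

theorem pairTPP_image {G' : Type*} [Group G'] [DecidableEq G'] (φ : G →* G')
    (hφ : Function.Injective φ) {S T : Finset G} (h : PairTPP S T) :
    PairTPP (S.image φ) (T.image φ) := by
  intro x hx x' hx' y hy y' hy' heq
  obtain ⟨s, hs, rfl⟩ := Finset.mem_image.1 hx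
  obtain ⟨s', hs', rfl⟩ := Finset.mem_image.1 hx'
  obtain ⟨t, ht, rfl⟩ := Finset.mem_image.1 hy
  obtain ⟨t', ht', rfl⟩ := Finset.mem_image.1 hy'
  have key : φ (s * s'⁻¹ * (t * t'⁻¹)) = φ 1 := by simpa [map_mul, map_inv] using heq
  obtain ⟨h1, h2⟩ := h s hs s' hs' t ht t' ht' (hφ key)
  exact ⟨by rw [h1], by rw [h2]⟩

end PairTPP

/-! ### The rooted triple inside `S_{2m}` -/

section Assembly

theorem card_Pt (m : ℕ) [NeZero m] : Fintype.card (Pt m) = 2 * m := by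
  simp only [Fintype.card_sum, ZMod.card]; ring

/-- Any bijection of the model with `Fin (2m)` (only its existence is used). -/
noncomputable def ptEquiv (m : ℕ) [NeZero m] : Pt m ≃ Fin (2 * m) :=
  Fintype.equivFinOfCardEq (card_Pt m)

/-- **The rooted hyperoctahedral triple** in `S_{2m}`, `m` odd: three sets of size
`(m-1)!·2^{m-1}` (inside the rooted stabilisers `K_0, K_1, K_2` of the matchings
`x ↦ 1-x, 3-x, 5-x` of `ℤ/2m`) with the PAIRWISE TPP. -/
theorem rooted_triple (m : ℕ) [NeZero m] (hm : Odd m) :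
    ∃ S T U : Finset (Equiv.Perm (Fin (2 * m))), PairwiseTPP S T U ∧
      S.card = (m - 1).factorial * 2 ^ (m - 1) ∧ T.card = (m - 1).factorial * 2 ^ (m - 1) ∧
      U.card = (m - 1).factorial * 2 ^ (m - 1) := by
  classical
  let φ : Equiv.Perm (Pt m) →* Equiv.Perm (Fin (2 * m)) := (ptEquiv m).permCongrHom.toMonoidHom
  have hφ : Function.Injective φ := (ptEquiv m).permCongrHom.injective
  refine ⟨(rooted 0).image φ, (rooted 1).image φ, (rooted 2).image φ, ⟨?_, ?_, ?_⟩, ?_, ?_, ?_⟩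
  · exact pairTPP_image φ hφ (pairTPP_of_inf_eq_bot K0_inf_K1 (rooted_subset_K 0) (rooted_subset_K 1))
  · exact pairTPP_image φ hφ (pairTPP_of_inf_eq_bot K1_inf_K2 (rooted_subset_K 1) (rooted_subset_K 2))
  · exact pairTPP_image φ hφ
      (pairTPP_of_inf_eq_bot (K2_inf_K0 hm) (rooted_subset_K 2) (rooted_subset_K 0))
  all_goals rw [Finset.card_image_of_injective _ hφ, card_rooted]

/-- The counting: with `N = (m-1)!·2^{m-1}` and `n = 2m`, `N·n = m!·2^m`, `(n!) ≤ (N n)²`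
(central binomial coefficient `≤ 4^m`), so `(n!)^{3/2} ≤ N³ n³ < N³ e^{c√n}` once
`c⁸ n > 8! = 40320` (from `e^x ≥ x⁸/8!`). -/
theorem rooted_arith {c : ℝ} (hc : 0 < c) (m : ℕ) (hm : 1 ≤ m)
    (hlarge : (40320 : ℝ) < c ^ 8 * ((2 * m : ℕ) : ℝ)) :
    (((2 * m).factorial : ℕ) : ℝ) ^ ((3 : ℝ) / 2) * Real.exp (-(c * Real.sqrt ((2 * m : ℕ) : ℝ))) <
      (((m - 1).factorial * 2 ^ (m - 1) * ((m - 1).factorial * 2 ^ (m - 1)) *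
        ((m - 1).factorial * 2 ^ (m - 1)) : ℕ) : ℝ) := by
  have hc0 : 0 ≤ c := hc.le
  set N : ℕ := (m - 1).factorial * 2 ^ (m - 1) with hN
  set n : ℕ := 2 * m with hn
  have hNn : N * n = m.factorial * 2 ^ m := by
    rw [hN, hn]
    have h1 : m * (m - 1).factorial = m.factorial := Nat.mul_factorial_pred (by omega)
    have h2 : 2 * 2 ^ (m - 1) = 2 ^ m := by
      rw [← pow_succ']; congr 1; omega
    calc (m - 1).factorial * 2 ^ (m - 1) * (2 * m)
        = (m * (m - 1).factorial) * (2 * 2 ^ (m - 1)) := by ring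
      _ = m.factorial * 2 ^ m := by rw [h1, h2]
  have hfact : n.factorial ≤ (N * n) ^ 2 := by
    rw [hNn, hn]
    have hc' := Nat.choose_mul_factorial_mul_factorial (show m ≤ 2 * m by omega)
    rw [show 2 * m - m = m by omega, ← Nat.centralBinom_eq_two_mul_choose] at hc'
    calc (2 * m).factorial = Nat.centralBinom m * m.factorial * m.factorial := hc'.symm
      _ ≤ 4 ^ m * m.factorial * m.factorial := by
          gcongr
          exact Nat.centralBinom_le_four_pow m
      _ = (m.factorial * 2 ^ m) ^ 2 := by
          rw [show (4 : ℕ) = 2 ^ 2 by norm_num, ← pow_mul]; ring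
  have hn0 : (0 : ℝ) < (n : ℝ) := by
    rw [hn]; exact_mod_cast (by omega : 0 < 2 * m)
  have hNnpos : (0 : ℝ) < ((N * n : ℕ) : ℝ) := by
    rw [hNn]; exact_mod_cast Nat.mul_pos (Nat.factorial_pos m) (pow_pos two_pos m)
  have hNn0 : (0 : ℝ) ≤ ((N * n : ℕ) : ℝ) := hNnpos.le
  have h1 : ((n.factorial : ℕ) : ℝ) ^ ((3 : ℝ) / 2) ≤ ((N * n : ℕ) : ℝ) ^ 3 := by
    have hle : ((n.factorial : ℕ) : ℝ) ≤ ((N * n : ℕ) : ℝ) ^ 2 := by exact_mod_cast hfact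
    calc ((n.factorial : ℕ) : ℝ) ^ ((3 : ℝ) / 2) ≤ (((N * n : ℕ) : ℝ) ^ 2) ^ ((3 : ℝ) / 2) :=
          Real.rpow_le_rpow (Nat.cast_nonneg _) hle (by norm_num)
      _ = ((N * n : ℕ) : ℝ) ^ 3 := by
          rw [← Real.rpow_two, ← Real.rpow_mul hNn0,
            show (2 : ℝ) * (3 / 2) = ((3 : ℕ) : ℝ) by norm_num, Real.rpow_natCast]
  have h2 : (n : ℝ) ^ 3 < Real.exp (c * Real.sqrt n) := by
    have hx : 0 ≤ c * Real.sqrt n := by positivity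
    have h8 := Real.pow_div_factorial_le_exp (c * Real.sqrt n) hx 8
    have hs : Real.sqrt (n : ℝ) ^ 8 = (n : ℝ) ^ 4 := by
      rw [show (8 : ℕ) = 2 * 4 by norm_num, pow_mul, Real.sq_sqrt hn0.le]
    rw [mul_pow, hs] at h8
    have hf : ((Nat.factorial 8 : ℕ) : ℝ) = 40320 := by norm_num [Nat.factorial]
    rw [hf] at h8
    refine lt_of_lt_of_le ?_ h8
    rw [lt_div_iff₀ (by norm_num : (0 : ℝ) < 40320)]
    calc (n : ℝ) ^ 3 * 40320 < (n : ℝ) ^ 3 * (c ^ 8 * n) :=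
          mul_lt_mul_of_pos_left hlarge (by positivity)
      _ = c ^ 8 * (n : ℝ) ^ 4 := by ring
  have h3 : Real.exp (-(c * Real.sqrt n)) * (n : ℝ) ^ 3 < 1 := by
    rw [Real.exp_neg, inv_mul_lt_iff₀ (Real.exp_pos _), mul_one]
    exact h2
  have hcast : ((N * N * N : ℕ) : ℝ) = ((N * n : ℕ) : ℝ) ^ 3 / (n : ℝ) ^ 3 := by
    rw [eq_div_iff (by positivity)]
    push_cast
    ring
  rw [hcast, lt_div_iff₀ (by positivity)]
  calc ((n.factorial : ℕ) : ℝ) ^ ((3 : ℝ) / 2) * Real.exp (-(c * Real.sqrt n)) * (n : ℝ) ^ 3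
      = ((n.factorial : ℕ) : ℝ) ^ ((3 : ℝ) / 2) * (Real.exp (-(c * Real.sqrt n)) * (n : ℝ) ^ 3) := by
        ring
    _ < ((N * n : ℕ) : ℝ) ^ 3 * 1 := mul_lt_mul' h1 h3 (by positivity) (by positivity)
    _ = ((N * n : ℕ) : ℝ) ^ 3 := mul_one _

/-- The crux with the TPP weakened to the PAIRWISE TPP. -/
def NoThresholdSubsetTripleWithPairwiseTPP : Prop :=
  ∃ c : ℝ, 0 < c ∧ ∃ n₀ : ℕ, ∀ n ≥ n₀, ∀ S T U : Finset (Equiv.Perm (Fin n)),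
    PairwiseTPP S T U →
      ((S.card * T.card * U.card : ℕ) : ℝ) ≤
        (n.factorial : ℝ) ^ ((3 : ℝ) / 2) * Real.exp (-(c * Real.sqrt (n : ℝ)))

/-- **Any proof must use the genuine three-fold condition**: under the pairwise TPP alone the
bound fails for every `c > 0` — the rooted hyperoctahedral triple has
`|S||T||U| ≥ (n!)^{3/2}/n³ > (n!)^{3/2} e^{-c√n}` (polynomial slack; the knife edge of the
route texts, = route `SnThresholdCensus` item `PairwiseTrivialAtThreshold`). -/
theorem false_with_pairwise_only : ¬ NoThresholdSubsetTripleWithPairwiseTPP := by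
  rintro ⟨c, hc, n₀, h⟩
  set k : ℕ := n₀ + ⌈(40320 : ℝ) / c ^ 8⌉₊ + 1 with hk
  set m : ℕ := 2 * k + 1 with hm
  haveI : NeZero m := ⟨by omega⟩
  have hodd : Odd m := ⟨k, rfl⟩
  obtain ⟨S, T, U, hP, hS, hT, hU⟩ := rooted_triple m hodd
  have hn₀ : n₀ ≤ 2 * m := by omega
  have key := h (2 * m) hn₀ S T U hP
  rw [hS, hT, hU] at key
  have hlarge : (40320 : ℝ) < c ^ 8 * ((2 * m : ℕ) : ℝ) := by
    have hc8 : 0 < c ^ 8 := by positivity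
    have hceil : (40320 : ℝ) / c ^ 8 ≤ ⌈(40320 : ℝ) / c ^ 8⌉₊ := Nat.le_ceil _
    have hlt : (⌈(40320 : ℝ) / c ^ 8⌉₊ : ℝ) < ((2 * m : ℕ) : ℝ) := by
      exact_mod_cast (show ⌈(40320 : ℝ) / c ^ 8⌉₊ < 2 * m by omega)
    have := (div_lt_iff₀' hc8).1 (hceil.trans_lt hlt)
    linarith
  exact absurd key (not_le.2 (rooted_arith hc m (by omega) hlarge))

end Assembly

/-- **The rooted SUBGROUP triple violates the genuine TPP** already at `m = 3` (`n = 6`):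
`q₁ q₃ q₅ = 1` with the involutions `q₅ = (inl 1, inr 1) ∈ K_2`, `q₃ = (inl 2, inr 2) ∈ K_1`,
`q₁ = q₅ q₃ ∈ K_0`.  (Kit: the violating fraction `|K_2 ∩ K_1 K_0|/|K|` stays ≈ `1/3` up to
`m = 7`, see §5.)  So §6 is exactly the pairwise phenomenon; it carries no threshold design. -/
theorem rooted_subgroups_not_tpp_m3 :
    ¬ (∀ q₁ ∈ K (0 : ZMod 3), ∀ q₃ ∈ K (1 : ZMod 3), ∀ q₅ ∈ K (2 : ZMod 3),
        q₁ * q₃ * q₅ = 1 → q₁ = 1 ∧ q₃ = 1 ∧ q₅ = 1) := by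
  intro h
  have h5 : (Equiv.swap (Sum.inl 1) (Sum.inr 1) : Equiv.Perm (Pt 3)) ∈ K (2 : ZMod 3) := by
    rw [mem_K]; decide
  have h3 : (Equiv.swap (Sum.inl 2) (Sum.inr 2) : Equiv.Perm (Pt 3)) ∈ K (1 : ZMod 3) := by
    rw [mem_K]; decide
  have h1 : (Equiv.swap (Sum.inl 1) (Sum.inr 1) * Equiv.swap (Sum.inl 2) (Sum.inr 2) :
      Equiv.Perm (Pt 3)) ∈ K (0 : ZMod 3) := by
    rw [mem_K]; decide
  have key := h _ h1 _ h3 _ h5 (by decide)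
  exact absurd key.2.2 (by decide)

/-! ## §7  The crux is the STRONGEST negative statement of the route; open strengthenings

`NoThresholdSubsetTriple ⇒ HyperoctahedralSubsets` (specialisation to matching-stabiliser hosts) and
`NoThresholdSubsetTriple ⇒ PolynomialSlack` (`n^C e^{-c√n} ≤ 1` eventually).  Contrapositively a
refutation of EITHER sibling crux refutes this one (and proves `ω = 2` by §0) — the cheapest
conceivable kills are therefore the siblings' falsifiers: a TPP triple of poly-index subsets of
three `B(M_i)` (kit jobs j005880/j005898, GAP census of hosted SUBGROUP triples at `n = 8, 10`;
j005002 for the rooted stabilisers, negative so far: violation density ≈ 1/3).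

OPEN STRENGTHENINGS (recorded, not decidable here): (i) `e^{-c√n} → e^{-cn}`: consistent with all
known triples (Young/triangle constructions lose `e^{-Θ(n)}`, §4), no refutation available;
(ii) uniform in `c` (`∀ c ∃ n₀`), i.e. saving `e^{-ω(√n)}`: refuting it needs a TPP family within
`e^{-O(√n)}` of packing — none known (it would not yet give `ω = 2`, which needs `e^{-o(√n)}`);
(iii) the best PROVED saving is `√(n(S_n)) = √(n-1)` (BCGPU 2023 Thm 3.2, tree theorem
`BCGPU2023_thm32_holds`), i.e. the crux with `c√n` replaced by `½ log(n-1) - O(1)`. -/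

/-- crux ⇒ `HyperoctahedralSubsets` (the knife-edge crux is a special case). -/
theorem hyperoctahedralSubsets_of_crux (h : NoThresholdSubsetTriple) : HyperoctahedralSubsets := by
  obtain ⟨c, hc, n₀, h⟩ := h
  exact ⟨c, hc, n₀, fun n hn _ _ X _ hTPP => h n hn (X 0) (X 1) (X 2) hTPP⟩

/-- `n^C ≤ e^{c√n}` eventually (`c > 0`; from `log n ≤ 4 n^{1/4}`). -/
theorem rpow_le_exp_sqrt {c : ℝ} (hc : 0 < c) (C : ℝ) :
    ∃ n₁ : ℕ, ∀ n : ℕ, n₁ ≤ n → (n : ℝ) ^ C ≤ Real.exp (c * Real.sqrt n) := by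
  by_cases hC : C ≤ 0
  · refine ⟨1, fun n hn => ?_⟩
    have h1 : (1 : ℝ) ≤ n := by exact_mod_cast hn
    calc (n : ℝ) ^ C ≤ 1 := Real.rpow_le_one_of_one_le_of_nonpos h1 hC
      _ ≤ Real.exp (c * Real.sqrt n) := Real.one_le_exp_iff.2 (by positivity)
  · push Not at hC
    refine ⟨max 1 ⌈((4 * C / c) ^ 4 : ℝ)⌉₊, fun n hn => ?_⟩
    have hn1 : (1 : ℝ) ≤ n := by exact_mod_cast (le_max_left _ _).trans hn
    have hn0 : (0 : ℝ) < n := by linarith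
    have hceil : ((4 * C / c) ^ 4 : ℝ) ≤ n :=
      (Nat.le_ceil _).trans (by exact_mod_cast (le_max_right _ _).trans hn)
    have h0 : (0 : ℝ) ≤ 4 * C / c := by positivity
    have hK : 4 * C / c ≤ (n : ℝ) ^ ((1 : ℝ) / 4) := by
      calc 4 * C / c = ((4 * C / c) ^ 4) ^ ((4 : ℕ)⁻¹ : ℝ) :=
            (Real.pow_rpow_inv_natCast h0 (by norm_num)).symm
        _ ≤ (n : ℝ) ^ ((4 : ℕ)⁻¹ : ℝ) := Real.rpow_le_rpow (by positivity) hceil (by positivity)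
        _ = (n : ℝ) ^ ((1 : ℝ) / 4) := by norm_num
    have hlog : Real.log n ≤ (n : ℝ) ^ ((1 : ℝ) / 4) / (1 / 4) :=
      Real.log_le_rpow_div hn0.le (by norm_num)
    rw [Real.rpow_def_of_pos hn0, Real.exp_le_exp]
    have hsqrt : Real.sqrt n = (n : ℝ) ^ ((1 : ℝ) / 4) * (n : ℝ) ^ ((1 : ℝ) / 4) := by
      rw [Real.sqrt_eq_rpow, ← Real.rpow_add hn0]; norm_num
    rw [hsqrt]
    have hB : 0 ≤ (n : ℝ) ^ ((1 : ℝ) / 4) := by positivity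
    have h4C : 4 * C = 4 * C / c * c := by field_simp
    calc Real.log n * C ≤ ((n : ℝ) ^ ((1 : ℝ) / 4) / (1 / 4)) * C := by gcongr
      _ = (n : ℝ) ^ ((1 : ℝ) / 4) * (4 * C) := by ring
      _ = (n : ℝ) ^ ((1 : ℝ) / 4) * (4 * C / c * c) := by rw [← h4C]
      _ ≤ (n : ℝ) ^ ((1 : ℝ) / 4) * ((n : ℝ) ^ ((1 : ℝ) / 4) * c) := by gcongr
      _ = c * ((n : ℝ) ^ ((1 : ℝ) / 4) * (n : ℝ) ^ ((1 : ℝ) / 4)) := by ring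

/-- crux ⇒ `PolynomialSlack` (the super-polynomial-saving crux is weaker). -/
theorem polynomialSlack_of_crux (h : NoThresholdSubsetTriple) : PolynomialSlack := by
  obtain ⟨c, hc, n₀, h⟩ := h
  intro C
  obtain ⟨n₁, hn₁⟩ := rpow_le_exp_sqrt hc C
  refine ⟨max n₀ n₁, fun n hn S T U hTPP => ?_⟩
  have key := h n ((le_max_left _ _).trans hn) S T U hTPP
  have hn1 := hn₁ n ((le_max_right _ _).trans hn)
  have hexp : Real.exp (-(c * Real.sqrt n)) * (n : ℝ) ^ C ≤ 1 := by
    rw [Real.exp_neg, inv_mul_le_iff₀ (Real.exp_pos _), mul_one]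
    exact hn1
  have hC0 : 0 ≤ (n : ℝ) ^ C := Real.rpow_nonneg (Nat.cast_nonneg _) _
  calc ((S.card * T.card * U.card : ℕ) : ℝ) * (n : ℝ) ^ C
      ≤ (n.factorial : ℝ) ^ ((3 : ℝ) / 2) * Real.exp (-(c * Real.sqrt n)) * (n : ℝ) ^ C := by
        gcongr
    _ = (n.factorial : ℝ) ^ ((3 : ℝ) / 2) * (Real.exp (-(c * Real.sqrt n)) * (n : ℝ) ^ C) := by
        ring
    _ ≤ (n.factorial : ℝ) ^ ((3 : ℝ) / 2) * 1 := by gcongr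
    _ = _ := mul_one _

/-! ## §8  Shape of a hypothetical counterexample: threshold triples are balanced

If a TPP triple beats `(n!)^{3/2} e^{-c√n}` then, by the pairwise packing bounds `|T||U| ≤ n!` etc.,
EACH of the three sets has `√(n!)·e^{-c√n} < |X| < √(n!)·e^{c√n}`: a threshold design consists of
three sets of size `√(n!)·e^{O(√n)}` — hosts of smaller order (e.g. Young subgroups `S_λ` with
`|S_λ| ≤ √(n!) e^{-ω(√n)}`) or larger sets are excluded a priori.  (Search-space reduction for
`HyperoctahedralThreshold` / the census, and the normalisation any proof may assume.) -/

/-- `x^{3/2} = x · √x` for `x ≥ 0`. -/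
theorem rpow_three_halves' {x : ℝ} (hx : 0 ≤ x) : x ^ ((3 : ℝ) / 2) = x * Real.sqrt x := by
  rw [Real.sqrt_eq_rpow, show (3 : ℝ) / 2 = 1 + 1 / 2 by norm_num,
    Real.rpow_add' hx (by norm_num), Real.rpow_one]

/-- **Lower balance**: in a TPP triple beating `(n!)^{3/2} e^{-c√n}` the first set has
`|S| > √(n!)·e^{-c√n}` (from `|T||U| ≤ n!`). -/
theorem card_gt_of_threshold {n : ℕ} {c : ℝ} {S T U : Finset (Equiv.Perm (Fin n))}
    (h : TripleProductProperty S T U)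
    (hbig : (n.factorial : ℝ) ^ ((3 : ℝ) / 2) * Real.exp (-(c * Real.sqrt (n : ℝ))) <
      ((S.card * T.card * U.card : ℕ) : ℝ)) :
    Real.sqrt (n.factorial : ℝ) * Real.exp (-(c * Real.sqrt (n : ℝ))) < (S.card : ℝ) := by
  have hF : (0 : ℝ) < (n.factorial : ℝ) := by exact_mod_cast n.factorial_pos
  have hpos : (0 : ℝ) < ((S.card * T.card * U.card : ℕ) : ℝ) :=
    lt_of_le_of_lt (by positivity) hbig
  have hS : S.Nonempty := by
    rw [← Finset.card_pos]; by_contra h0; push Not at h0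
    have : S.card = 0 := by omega
    rw [this] at hpos; simp at hpos
  have hTU : T.card * U.card ≤ n.factorial := card_mul_le_factorial h.rotate hS
  have hTU' : ((T.card * U.card : ℕ) : ℝ) ≤ n.factorial := by exact_mod_cast hTU
  -- |S| · n! ≥ |S||T||U| > n! √(n!) e^{-c√n}
  have key : (n.factorial : ℝ) * (Real.sqrt (n.factorial : ℝ) * Real.exp (-(c * Real.sqrt n))) <
      (n.factorial : ℝ) * (S.card : ℝ) := by
    calc (n.factorial : ℝ) * (Real.sqrt (n.factorial : ℝ) * Real.exp (-(c * Real.sqrt n)))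
        = (n.factorial : ℝ) ^ ((3 : ℝ) / 2) * Real.exp (-(c * Real.sqrt n)) := by
          rw [rpow_three_halves' hF.le]; ring
      _ < ((S.card * T.card * U.card : ℕ) : ℝ) := hbig
      _ = (S.card : ℝ) * ((T.card * U.card : ℕ) : ℝ) := by push_cast; ring
      _ ≤ (S.card : ℝ) * (n.factorial : ℝ) := by gcongr
      _ = (n.factorial : ℝ) * (S.card : ℝ) := by ring
  exact lt_of_mul_lt_mul_left key hF.le

/-- **Upper balance**: in a TPP triple beating `(n!)^{3/2} e^{-c√n}` the first set has
`|S| < √(n!)·e^{c√n}` (from `|S||T| ≤ n!` and the lower balance of `T`). -/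
theorem card_lt_of_threshold {n : ℕ} {c : ℝ} {S T U : Finset (Equiv.Perm (Fin n))}
    (h : TripleProductProperty S T U)
    (hbig : (n.factorial : ℝ) ^ ((3 : ℝ) / 2) * Real.exp (-(c * Real.sqrt (n : ℝ))) <
      ((S.card * T.card * U.card : ℕ) : ℝ)) :
    (S.card : ℝ) < Real.sqrt (n.factorial : ℝ) * Real.exp (c * Real.sqrt (n : ℝ)) := by
  have hF : (0 : ℝ) < (n.factorial : ℝ) := by exact_mod_cast n.factorial_pos
  have hsq : (0 : ℝ) < Real.sqrt (n.factorial : ℝ) := Real.sqrt_pos.2 hF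
  have hpos : (0 : ℝ) < ((S.card * T.card * U.card : ℕ) : ℝ) :=
    lt_of_le_of_lt (by positivity) hbig
  have hU : U.Nonempty := by
    rw [← Finset.card_pos]; by_contra h0; push Not at h0
    have : U.card = 0 := by omega
    rw [this] at hpos; simp at hpos
  -- lower balance for T (rotate the triple: volume is invariant)
  have hbigT : (n.factorial : ℝ) ^ ((3 : ℝ) / 2) * Real.exp (-(c * Real.sqrt (n : ℝ))) <
      ((T.card * U.card * S.card : ℕ) : ℝ) := by
    rwa [show T.card * U.card * S.card = S.card * T.card * U.card by ring]
  have hT := card_gt_of_threshold h.rotate hbigT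
  have hST : ((S.card * T.card : ℕ) : ℝ) ≤ n.factorial := by
    exact_mod_cast card_mul_le_factorial h hU
  -- |S| · (√(n!) e^{-c√n}) < |S| |T| ≤ n! = √(n!) e^{c√n} · (√(n!) e^{-c√n})
  have hE : 0 < Real.sqrt (n.factorial : ℝ) * Real.exp (-(c * Real.sqrt n)) := by positivity
  by_contra hle
  push Not at hle
  have h1 : (Real.sqrt (n.factorial : ℝ) * Real.exp (c * Real.sqrt n)) *
      (Real.sqrt (n.factorial : ℝ) * Real.exp (-(c * Real.sqrt n))) = n.factorial := by
    rw [Real.exp_neg]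
    field_simp
    rw [Real.sq_sqrt hF.le]
  have hS0 : (0 : ℝ) ≤ S.card := Nat.cast_nonneg _
  have h2 : (n.factorial : ℝ) < (S.card : ℝ) * (T.card : ℝ) := by
    calc (n.factorial : ℝ)
        = (Real.sqrt (n.factorial : ℝ) * Real.exp (c * Real.sqrt n)) *
            (Real.sqrt (n.factorial : ℝ) * Real.exp (-(c * Real.sqrt n))) := h1.symm
      _ ≤ (S.card : ℝ) * (Real.sqrt (n.factorial : ℝ) * Real.exp (-(c * Real.sqrt n))) := by
          gcongr
      _ < (S.card : ℝ) * (T.card : ℝ) := by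
          refine mul_lt_mul_of_pos_left hT ?_
          -- S.card > 0 from the lower balance of S
          exact lt_of_le_of_lt (by positivity) (card_gt_of_threshold h hbig)
  have : ((S.card * T.card : ℕ) : ℝ) = (S.card : ℝ) * (T.card : ℝ) := by push_cast; ring
  linarith [hST, h2, this]

/-! ## §9  Targets — the picked line `two-modular-loewy-slice-rank` and its open stub
`stub_radicalWindow` (lead's PICKED.md, 2026-08-16)

The line proves the crux from a two-modular slice-rank saving, cut as: `stub_transfer` (LANDED),
`stub_codim` (LANDED), `stub_semisimpleFloor` (known mathematics: `Σ_{λ strict}(f^λ)² ≤ n!e^{-K√n}`,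
LDS lower tail — true), and the OPEN bet `stub_radicalWindow`:
`∃ K>0 ∀ᶠ n ∃ a b, (dim J − dim J^a) + (dim J − dim J^b) + dim J^{a+b} ≤ n!·e^{−K√n}`,
`J = rad 𝔽̄₂[S_n]`.  This section isolates its COMBINATORIAL CONTENT (all proved, and instantiated
on the line's own objects `J⟦n⟧`, same notation):

* `radicalWindow_iff_loewyWindow` — **reshaped stub**: `stub_radicalWindow ↔ LoewyWindow`, where
  `LoewyWindow := ∃ K>0 ∀ᶠ n ∃ b ≥ 1, (dim J − dim J^b) + dim J^{2b} ≤ n!·e^{−K√n}`: ALL BUT A THIN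
  PART OF THE RADICAL LIVES IN THE LOEWY LAYERS `[b, 2b)` — the top non-negligible layer index must
  be less than TWICE the bottom one (rates differ by the factor 2; `absorb_two_add_one`).
* `thin_of_radicalWindow` — **necessary condition** (the cheapest numerical falsifier):
  `stub_radicalWindow ⇒ ∀ᶠ n, r₁(n) := dim J/J² ≤ n!e^{−K√n} + 1  ∨  dim J² ≤ n!e^{−K√n}`.
  Since `dim J² ≥ n!/2` is beyond doubt for large `n` (Loewy length ≥ 3 with fat layers), the stub
  DIES as soon as the first radical layer is fat: `r₁(n) ≥ n!·e^{−o(√n)}` along a sequence.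
  `r₁ = Σ_{λ,μ 2-regular} dim Ext¹(D^λ,D^μ)·d_λ d_μ`; the floor `r₀ = Σ d_λ² ≈ n!e^{−0.9√n}` is thin,
  so the question is whether Ext¹-multiplicities / fan-out lift `r₁` from `r₀`-size to `n!`-size.
* DATA (lead's kit j006679, Loewy layers of `𝔽₂S_n`, `n = 4..7`: `[5,9,5,5]`, `[33,25,9,18,9,9,17]`,
  `[289,49,50,50,50,50,50,50,49,33]`, `[697,993,958,766,797,729,100]`): the window statistic
  `W(n) := min_{b≥1} [(dim J − dim J^b) + dim J^{2b}] / n! = 0.375, 0.425, 0.276, 0.407`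
  (attained at `b = 2, 3, 5, 3`), the stub's own `min_{a,b} spill/n! = 0.417, 0.517, 0.528, 0.665`,
  `r₁/n! = 0.375, 0.208, 0.068, 0.197`, `dim J²/n! = 0.417, 0.517, 0.531, 0.665` — no decay of any
  of them (the stub needs `W(n) ≤ e^{−K√n}`); small `n`, but these are the right statistics to track
  at `n = 8, 9` (block-wise MeatAxe / PIM Loewy series).
* SCALE REMARK (why the window is demanding): if the layer masses `r_i/dim J` follow a bell profile
  with centre `m` and standard deviation `σ`, then `e^{−K√n}`-thin tails need `≈ √(2K)·n^{1/4}`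
  standard deviations, and the window `[b,2b)` needs the lower cut `m − tσ ≥ (m + tσ)/2`, i.e.
  `m ≥ 3tσ ≈ 3√(2K) n^{1/4} σ`; with the card's width guess `σ ≈ 0.7 n^{3/4}` this forces Loewy length
  `≳ 6√(2K)·n` — linear in `n` with a constant that caps `K` (Loewy lengths of 2-blocks of `S_n`
  are not known to exceed `O(n)`), and in addition ALL low layers `1 ≤ i < b ≈ n` must be
  `e^{−K√n}`-thin.  For the defect-group algebras `𝔽₂[C₂^k]` (binomial Jennings profile, `σ ≈ √k/2`,
  centre `k/2`) the analogous window at precision `e^{−K·2^{k/2}}` FAILS for large `k` (every layer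
  carries `≥ 2^{−k} ≫ e^{−K 2^{k/2}}` of the mass): BCCGU's Lemma 3.3 wins there only because it needs
  precision `|G|^{−ε}`, not `e^{−K√|G|…}`; the line needs the much finer `e^{−K√n}` relative to `n!`. -/

section AbstractWindow

/-- **Dichotomy** forced by a radical-window inequality.  For `D a := dim J^a` (`D 0 = 1`,
`D` non-negative, antitone from index `1` on): `(D1 - Da) + (D1 - Db) + D(a+b) ≤ B` for some
`a, b` forces EITHER a thin first Loewy layer `D1 - D2 ≤ B + 1` OR a thin square `D2 ≤ B`. -/
theorem window_dichotomy {D : ℕ → ℝ} {B : ℝ} (h0 : D 0 = 1) (hnn : ∀ a, 0 ≤ D a)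
    (hanti : ∀ i j : ℕ, 1 ≤ i → i ≤ j → D j ≤ D i)
    (h : ∃ a b : ℕ, (D 1 - D a) + (D 1 - D b) + D (a + b) ≤ B) :
    D 1 - D 2 ≤ B + 1 ∨ D 2 ≤ B := by
  obtain ⟨a, b, hab⟩ := h
  have h2 := hnn 2
  rcases Nat.eq_zero_or_pos a with rfl | ha
  · -- a = 0: spill = (D1 - 1) + (D1 - Db) + Db = 2 D1 - 1
    left
    rw [h0, zero_add] at hab
    have := hnn b
    linarith [hnn 1]
  rcases Nat.eq_zero_or_pos b with rfl | hb
  · left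
    rw [h0, add_zero] at hab
    linarith [hnn 1, hnn a]
  by_cases hab1 : a = 1 ∧ b = 1
  · obtain ⟨rfl, rfl⟩ := hab1
    right
    simpa using hab
  · -- one of them is ≥ 2
    left
    have hDa : D a ≤ D 1 := hanti 1 a le_rfl ha
    have hDb : D b ≤ D 1 := hanti 1 b le_rfl hb
    have hDab : 0 ≤ D (a + b) := hnn _
    rcases Nat.lt_or_ge a 2 with ha2 | ha2
    · have ha1 : a = 1 := by omega
      have hb2 : 2 ≤ b := by
        by_contra hcon
        exact hab1 ⟨ha1, by omega⟩
      have : D b ≤ D 2 := hanti 2 b (by norm_num) hb2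
      linarith
    · have : D a ≤ D 2 := hanti 2 a (by norm_num) ha2
      linarith

/-- **Window form, necessity**: the radical-window inequality gives a `b ≥ 1` with
`(D1 - Db) + D(2b) ≤ 2B + 1`, i.e. all but a thin part of the radical sits in layers `[b, 2b)`. -/
theorem window_of_radicalWindow {D : ℕ → ℝ} {B : ℝ} (h0 : D 0 = 1) (hnn : ∀ a, 0 ≤ D a)
    (hanti : ∀ i j : ℕ, 1 ≤ i → i ≤ j → D j ≤ D i) (hB : 0 ≤ B)
    (h : ∃ a b : ℕ, (D 1 - D a) + (D 1 - D b) + D (a + b) ≤ B) :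
    ∃ b : ℕ, 1 ≤ b ∧ (D 1 - D b) + D (2 * b) ≤ 2 * B + 1 := by
  obtain ⟨a, b, hab⟩ := h
  -- symmetric roles: arrange a ≤ b
  wlog hle : a ≤ b generalizing a b
  · exact this b a (by rw [Nat.add_comm]; linarith) (by omega)
  rcases Nat.eq_zero_or_pos a with rfl | ha
  · -- a = 0 ⇒ D1 ≤ (B+1)/2; take the window b = 1
    rw [h0, zero_add] at hab
    refine ⟨1, le_rfl, ?_⟩
    have := hnn b
    have h21 : D 2 ≤ D 1 := hanti 1 2 le_rfl (by norm_num)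
    simp only [mul_one, sub_self, zero_add]
    linarith [hnn 1]
  have hb : 1 ≤ b := by omega
  refine ⟨b, hb, ?_⟩
  have hDa : D a ≤ D 1 := hanti 1 a le_rfl ha
  have h2b : D (2 * b) ≤ D (a + b) := hanti (a + b) (2 * b) (by omega) (by omega)
  linarith [hnn (a + b)]

/-- **Window form, sufficiency**: a window `[b, 2b)` carrying all but `B` gives the radical-window
inequality with `a := b` and bound `2B`. -/
theorem radicalWindow_of_window {D : ℕ → ℝ} {B : ℝ} (hnn : ∀ a, 0 ≤ D a)
    (h : ∃ b : ℕ, (D 1 - D b) + D (2 * b) ≤ B) :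
    ∃ a b : ℕ, (D 1 - D a) + (D 1 - D b) + D (a + b) ≤ 2 * B := by
  obtain ⟨b, hb⟩ := h
  refine ⟨b, b, ?_⟩
  have e : D (b + b) = D (2 * b) := by rw [two_mul]
  rw [e]
  linarith [hnn (2 * b)]

end AbstractWindow

/-! ### The ideal powers: `dim J^a` is antitone from `a = 1` on, `dim J^0 = 1` -/

section IdealPowers

variable {F A : Type*} [Field F] [Ring A] [Algebra F A]

/-- For a two-sided ideal `I` of an `F`-algebra viewed as an `F`-subspace, every positive submodule
power is closed under right multiplication by the algebra. -/
theorem pow_mul_mem (I : Ideal A) [I.IsTwoSided] :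
    ∀ k : ℕ, 1 ≤ k → ∀ x ∈ (I.restrictScalars F) ^ k, ∀ y : A, x * y ∈ (I.restrictScalars F) ^ k := by
  intro k hk
  induction k, hk using Nat.le_induction with
  | base =>
    intro x hx y
    rw [pow_one] at hx ⊢
    exact I.mul_mem_right y hx
  | succ k hk ih =>
    intro x hx y
    rw [pow_succ] at hx ⊢
    refine Submodule.mul_induction_on hx ?_ ?_
    · intro m hm n hn
      rw [mul_assoc]
      exact Submodule.mul_mem_mul hm (I.mul_mem_right y hn)
    · intro u v hu hv
      rw [add_mul]
      exact Submodule.add_mem _ hu hv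

/-- The submodule powers of a two-sided ideal decrease from exponent `1` on. -/
theorem pow_succ_le (I : Ideal A) [I.IsTwoSided] {k : ℕ} (hk : 1 ≤ k) :
    (I.restrictScalars F) ^ (k + 1) ≤ (I.restrictScalars F) ^ k := by
  rw [pow_succ, Submodule.mul_le]
  intro m hm n _
  exact pow_mul_mem I k hk m hm n

/-- Antitonicity of `a ↦ I^a` on `[1, ∞)`. -/
theorem pow_le_pow_of_le (I : Ideal A) [I.IsTwoSided] {i j : ℕ} (hi : 1 ≤ i) (hij : i ≤ j) :
    (I.restrictScalars F) ^ j ≤ (I.restrictScalars F) ^ i := by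
  induction j, hij using Nat.le_induction with
  | base => exact le_rfl
  | succ j hj ih => exact (pow_succ_le I (hi.trans hj)).trans ih

/-- `dim I^0 = dim (F·1) = 1` in a nontrivial algebra. -/
theorem finrank_pow_zero [Nontrivial A] (I : Ideal A) :
    Module.finrank F ↥((I.restrictScalars F) ^ 0) = 1 := by
  rw [pow_zero, Submodule.one_eq_span]
  exact finrank_span_singleton one_ne_zero

/-- The dimension function of the radical (or any two-sided ideal) filtration satisfies the
hypotheses of `window_dichotomy` / `window_of_radicalWindow`. -/
theorem dim_pow_props [Nontrivial A] [FiniteDimensional F A] (I : Ideal A) [I.IsTwoSided] :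
    (Module.finrank F ↥((I.restrictScalars F) ^ 0) : ℝ) = 1 ∧
    (∀ a : ℕ, (0 : ℝ) ≤ Module.finrank F ↥((I.restrictScalars F) ^ a)) ∧
    (∀ i j : ℕ, 1 ≤ i → i ≤ j →
      (Module.finrank F ↥((I.restrictScalars F) ^ j) : ℝ) ≤
        Module.finrank F ↥((I.restrictScalars F) ^ i)) := by
  refine ⟨by exact_mod_cast finrank_pow_zero (F := F) I, fun a => Nat.cast_nonneg _,
    fun i j hi hij => ?_⟩
  exact_mod_cast Submodule.finrank_mono (pow_le_pow_of_le (F := F) I hi hij)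

end IdealPowers

/-! ### Instantiation for the line's objects `J⟦n⟧ = rad 𝔽̄₂[S_n]` -/

section Line

local notation "𝕜" => AlgebraicClosure (ZMod 2)

local notation "J⟦" n "⟧" =>
  (Submodule.restrictScalars (AlgebraicClosure (ZMod 2))
    (Ring.jacobson (MonoidAlgebra (AlgebraicClosure (ZMod 2)) (Equiv.Perm (Fin n)))) :
      Submodule (AlgebraicClosure (ZMod 2))
        (MonoidAlgebra (AlgebraicClosure (ZMod 2)) (Equiv.Perm (Fin n))))

/-- The statement of `stub_radicalWindow` (line `two-modular-loewy-slice-rank`, verbatim). -/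
def RadicalWindow : Prop :=
    ∃ K : ℝ, 0 < K ∧ ∃ n₀ : ℕ, ∀ n ≥ n₀, ∃ a b : ℕ,
      ((Module.finrank 𝕜 J⟦n⟧ : ℝ) - (Module.finrank 𝕜 ↥(J⟦n⟧ ^ a) : ℝ)) +
        ((Module.finrank 𝕜 J⟦n⟧ : ℝ) - (Module.finrank 𝕜 ↥(J⟦n⟧ ^ b) : ℝ)) +
          (Module.finrank 𝕜 ↥(J⟦n⟧ ^ (a + b)) : ℝ) ≤
        (n.factorial : ℝ) * Real.exp (-(K * Real.sqrt (n : ℝ)))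

/-- The equivalent WINDOW form: all but `n!e^{-K√n}` of the radical lives in Loewy layers
`[b, 2b)`. -/
def LoewyWindow : Prop :=
    ∃ K : ℝ, 0 < K ∧ ∃ n₀ : ℕ, ∀ n ≥ n₀, ∃ b : ℕ, 1 ≤ b ∧
      ((Module.finrank 𝕜 J⟦n⟧ : ℝ) - (Module.finrank 𝕜 ↥(J⟦n⟧ ^ b) : ℝ)) +
          (Module.finrank 𝕜 ↥(J⟦n⟧ ^ (2 * b)) : ℝ) ≤
        (n.factorial : ℝ) * Real.exp (-(K * Real.sqrt (n : ℝ)))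

/-- The NECESSARY CONDITION to test numerically: thin first Loewy layer OR thin square. -/
def ThinFirstLayerOrSquare : Prop :=
    ∃ K : ℝ, 0 < K ∧ ∃ n₀ : ℕ, ∀ n ≥ n₀,
      ((Module.finrank 𝕜 J⟦n⟧ : ℝ) - (Module.finrank 𝕜 ↥(J⟦n⟧ ^ 2) : ℝ)) ≤
          (n.factorial : ℝ) * Real.exp (-(K * Real.sqrt (n : ℝ))) + 1 ∨
        (Module.finrank 𝕜 ↥(J⟦n⟧ ^ 2) : ℝ) ≤ (n.factorial : ℝ) * Real.exp (-(K * Real.sqrt (n : ℝ)))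

/-- Absorbing constants into the rate: `2·n!e^{-K√n} + 1 ≤ n!e^{-(K/2)√n}` eventually. -/
theorem absorb_two_add_one {K : ℝ} (hK : 0 < K) :
    ∃ n₁ : ℕ, ∀ n : ℕ, n₁ ≤ n →
      2 * ((n.factorial : ℝ) * Real.exp (-(K * Real.sqrt (n : ℝ)))) + 1 ≤
        (n.factorial : ℝ) * Real.exp (-(K / 2 * Real.sqrt (n : ℝ))) := by
  -- (a) 3 ≤ exp ((K/2)√n) for n ≥ Na ;  (b) exp (K√n) ≤ n! for n ≥ Nb
  refine ⟨max (max 1 ⌈(2 * Real.log 3 / K) ^ 2⌉₊) ⌈Real.exp (K + 1)⌉₊, fun n hn => ?_⟩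
  have hn1 : 1 ≤ n := le_trans (le_trans (le_max_left _ _) (le_max_left _ _)) hn
  have hn1R : (1 : ℝ) ≤ n := by exact_mod_cast hn1
  have hn0 : (0 : ℝ) < n := by linarith
  have hna : ((2 * Real.log 3 / K) ^ 2 : ℝ) ≤ n :=
    (Nat.le_ceil _).trans (by exact_mod_cast le_trans (le_trans (le_max_right _ _) (le_max_left _ _)) hn)
  have hnb : Real.exp (K + 1) ≤ n := (Nat.le_ceil _).trans (by exact_mod_cast (le_max_right _ _).trans hn)
  have hlog3 : 0 < Real.log 3 := Real.log_pos (by norm_num)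
  -- (a)
  have ha : (3 : ℝ) ≤ Real.exp (K / 2 * Real.sqrt n) := by
    have h1 : 2 * Real.log 3 / K ≤ Real.sqrt n := by
      rw [show (2 * Real.log 3 / K : ℝ) = Real.sqrt ((2 * Real.log 3 / K) ^ 2) by
        rw [Real.sqrt_sq (by positivity)]]
      exact Real.sqrt_le_sqrt hna
    have h2 : Real.log 3 ≤ K / 2 * Real.sqrt n := by
      have := mul_le_mul_of_nonneg_left h1 (by positivity : (0 : ℝ) ≤ K / 2)
      calc Real.log 3 = K / 2 * (2 * Real.log 3 / K) := by field_simp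
        _ ≤ K / 2 * Real.sqrt n := this
    calc (3 : ℝ) = Real.exp (Real.log 3) := (Real.exp_log (by norm_num)).symm
      _ ≤ Real.exp (K / 2 * Real.sqrt n) := Real.exp_le_exp.2 h2
  -- (b)
  have hb : Real.exp (K * Real.sqrt n) ≤ (n.factorial : ℝ) := by
    have hlogn : K + 1 ≤ Real.log n := by
      rw [← Real.log_exp (K + 1)]
      exact Real.log_le_log (Real.exp_pos _) hnb
    have hsqrt : Real.sqrt (n : ℝ) ≤ n := by
      have hs1 : 1 ≤ Real.sqrt (n : ℝ) := by
        rw [show (1 : ℝ) = Real.sqrt 1 by simp]; exact Real.sqrt_le_sqrt hn1R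
      calc Real.sqrt (n : ℝ) = Real.sqrt n * 1 := (mul_one _).symm
        _ ≤ Real.sqrt n * Real.sqrt n := by gcongr
        _ = n := Real.mul_self_sqrt hn0.le
    have hfac := Literature.Barriers.MatrixMultiplication.sub_le_log_factorial n
    -- K√n ≤ K n ≤ n log n - n ≤ log n!
    have h3 : K * Real.sqrt n ≤ Real.log (n.factorial : ℝ) := by
      calc K * Real.sqrt n ≤ K * n := by gcongr
        _ = (K + 1) * n - n := by ring
        _ ≤ Real.log n * n - n := by gcongr
        _ = n * Real.log n - n := by ring
        _ ≤ Real.log (n.factorial : ℝ) := hfac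
    calc Real.exp (K * Real.sqrt n) ≤ Real.exp (Real.log (n.factorial : ℝ)) := Real.exp_le_exp.2 h3
      _ = (n.factorial : ℝ) := Real.exp_log (by exact_mod_cast n.factorial_pos)
  -- combine: 2X + 1 ≤ 3X ≤ n! e^{-(K/2)√n}, X = n! e^{-K√n} ≥ 1
  have hF : (0 : ℝ) < n.factorial := by exact_mod_cast n.factorial_pos
  have hX1 : 1 ≤ (n.factorial : ℝ) * Real.exp (-(K * Real.sqrt n)) := by
    rw [Real.exp_neg, ← div_eq_mul_inv, le_div_iff₀ (Real.exp_pos _), one_mul]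
    exact hb
  have hsplit : Real.exp (-(K * Real.sqrt n)) =
      Real.exp (-(K / 2 * Real.sqrt n)) * Real.exp (-(K / 2 * Real.sqrt n)) := by
    rw [← Real.exp_add]; ring_nf
  have h3inv : 3 * Real.exp (-(K / 2 * Real.sqrt n)) ≤ 1 := by
    rw [Real.exp_neg, ← div_eq_mul_inv, div_le_one (Real.exp_pos _)]
    exact ha
  calc 2 * ((n.factorial : ℝ) * Real.exp (-(K * Real.sqrt n))) + 1
      ≤ 3 * ((n.factorial : ℝ) * Real.exp (-(K * Real.sqrt n))) := by linarith
    _ = (n.factorial : ℝ) * Real.exp (-(K / 2 * Real.sqrt n)) *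
          (3 * Real.exp (-(K / 2 * Real.sqrt n))) := by rw [hsplit]; ring
    _ ≤ (n.factorial : ℝ) * Real.exp (-(K / 2 * Real.sqrt n)) * 1 := by gcongr
    _ = _ := mul_one _

theorem finrank_J_eq_pow_one (n : ℕ) :
    (Module.finrank 𝕜 J⟦n⟧ : ℝ) = Module.finrank 𝕜 ↥(J⟦n⟧ ^ 1) := by
  rw [pow_one]

theorem thin_of_radicalWindow (h : RadicalWindow) : ThinFirstLayerOrSquare := by
  obtain ⟨K, hK, n₀, h⟩ := h
  refine ⟨K, hK, n₀, fun n hn => ?_⟩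
  obtain ⟨h0, hnn, hanti⟩ := dim_pow_props (F := 𝕜)
    (Ring.jacobson (MonoidAlgebra 𝕜 (Equiv.Perm (Fin n))))
  have key := window_dichotomy (D := fun a => (Module.finrank 𝕜 ↥(J⟦n⟧ ^ a) : ℝ)) h0 hnn hanti
    (by simpa only [← finrank_J_eq_pow_one] using h n hn)
  simpa only [← finrank_J_eq_pow_one] using key

/-- `stub_radicalWindow` ⇒ the window form (rate halved to absorb the constants). -/
theorem loewyWindow_of_radicalWindow (h : RadicalWindow) : LoewyWindow := by
  obtain ⟨K, hK, n₀, h⟩ := h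
  obtain ⟨n₁, hn₁⟩ := absorb_two_add_one hK
  refine ⟨K / 2, half_pos hK, max n₀ n₁, fun n hn => ?_⟩
  obtain ⟨h0, hnn, hanti⟩ := dim_pow_props (F := 𝕜)
    (Ring.jacobson (MonoidAlgebra 𝕜 (Equiv.Perm (Fin n))))
  have hB : (0 : ℝ) ≤ (n.factorial : ℝ) * Real.exp (-(K * Real.sqrt (n : ℝ))) := by positivity
  obtain ⟨b, hb, hwin⟩ := window_of_radicalWindow
    (D := fun a => (Module.finrank 𝕜 ↥(J⟦n⟧ ^ a) : ℝ)) h0 hnn hanti hB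
    (by simpa only [← finrank_J_eq_pow_one] using h n ((le_max_left _ _).trans hn))
  refine ⟨b, hb, ?_⟩
  have habs := hn₁ n ((le_max_right _ _).trans hn)
  rw [finrank_J_eq_pow_one]
  exact hwin.trans habs

/-- The window form ⇒ `stub_radicalWindow` (rate halved). -/
theorem radicalWindow_of_loewyWindow (h : LoewyWindow) : RadicalWindow := by
  obtain ⟨K, hK, n₀, h⟩ := h
  obtain ⟨n₁, hn₁⟩ := absorb_two_add_one hK
  refine ⟨K / 2, half_pos hK, max n₀ n₁, fun n hn => ?_⟩
  obtain ⟨-, hnn, -⟩ := dim_pow_props (F := 𝕜)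
    (Ring.jacobson (MonoidAlgebra 𝕜 (Equiv.Perm (Fin n))))
  obtain ⟨b, -, hb⟩ := h n ((le_max_left _ _).trans hn)
  obtain ⟨a, b', hab⟩ := radicalWindow_of_window
    (D := fun a => (Module.finrank 𝕜 ↥(J⟦n⟧ ^ a) : ℝ)) hnn
    ⟨b, by simpa only [← finrank_J_eq_pow_one] using hb⟩
  refine ⟨a, b', ?_⟩
  have habs := hn₁ n ((le_max_right _ _).trans hn)
  rw [finrank_J_eq_pow_one]
  refine hab.trans (le_trans ?_ habs)
  linarith

/-- **Reshaped stub**: `stub_radicalWindow ↔ LoewyWindow` (the rates differ by the harmless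
factor `2`, quantified existentially on both sides). -/
theorem radicalWindow_iff_loewyWindow : RadicalWindow ↔ LoewyWindow :=
  ⟨loewyWindow_of_radicalWindow, radicalWindow_of_loewyWindow⟩

end Line

end Summit.MatrixMultiplication.MatrixMultiplication.Cruxes.NoThresholdSubsetTriple.Disproof
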